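import Summits.NavierStokesRegularity.NavierStokesRegularity.Theses.PerpetualPump
import Summits.NavierStokesRegularity.NavierStokesRegularity.Theorems.CircuitTrace.Negative.Structure
import Literature.Analysis.FluidPDE.TaoCascadeODEHolds

/-!
# Disproof attempts on `PerpetualPump.CircuitTrace` (crux stmt-NavierStokesRegularity-1836)

Standing disprover's work file (refuter, cdisprove mode). `CircuitTrace` = dyadic ESS / trace
theorem: for EVERY `lam > 1` and EVERY Tao circuit (`m` modes per scale, structure constants
`coeff` symmetric (4.2) + cyclic-cancelling (4.3), class (4.3) at `α = 2/5`), a solution on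
`[0,T)` with no modes below scale `0`, a-priori `H¹⁰`-bounded on every `[0,T']`, `T' < T`, and
with bounded `ℓ³`-in-scale critical norm `sup_t Σ_{n,i} (lam^{n/5}|X_{i,n}|)³ ≤ M` stays
`H¹⁰`-bounded up to `T`.

## Findings (cycle 1, 2026-08-16) — NO KILL; the statement very probably holds

Landing: §0–§4 as `Theorems/CircuitTrace/Negative/LoadBearing.lean` (p73393) + `Negative/Structure.lean`,
§5 as `Negative/TaoBridge.lean` (proposed once LoadBearing is in tree); this work file keeps verbatim copies.

* FORMALISATION is faithful (§0): the route decl is definitionally `CircuitTrace'` below; the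
  `Option (Fin 3)` rendering of (4.2)/(4.3) was re-derived: the cyclic condition is EQUIVALENT to
  formal energy conservation of the nonlinearity (orbits of `S₃` on (index-triple, offset) ↔
  trilinear monomials is a bijection for the offset set `S`), see `trilinear_cancel`. No junk
  operators; `m = 0` and `coeff = 0` instances are true, not vacuous. Hypotheses are jointly
  satisfiable by non-trivial data (any `H¹⁰` datum of the linear flow; the class contains the
  Katz–Pavlović/Cheskidov scalar model `kpCoeff` and Tao's Table-2 circuit).
* LOAD-BEARING MAP (§1):
  - a-priori `H¹⁰` bound: NECESSARY — `circuitTrace_false_without_apriori` (proved): the linear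
    flow (`coeff = 0`) from the rough critical datum `X_n(0) = 2^{-3n}` has `ℓ³`-norm `≤ 2` forever
    and `sup_n 2^{4n}|X_n(0)| = ∞`. So the crux is a CONTINUATION criterion; the bound on `[0,T']`
    is also what makes every energy/flux series converge and every supremum over scales a maximum.
  - `ℓ³` bound: NECESSARY — `circuitTraceWithoutL3_false` (§5, proved MODULO the standard
    well-posedness input `MaximalH10Solutions` = maximal `H¹⁰` solutions with the blow-up
    alternative, not in tree): Tao's Thm 4.2 circuit (tree: `TaoCascade.odeBlowup_holds`, ε₀ = 1/2,
    `lam = (3/2)^{5/2}`, re-encoded by `coeffOf`, §5 bridge `circuitRHS_coeffOf`,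
    `isSymm_coeffOf`, `isCyclic_coeffOf`) admits no global regular solution from one excited mode
    (an exact solution is a `CascadeODESolution` with `E = X²/2`, `K₁ = √2`, `K₂ = 0`), so its
    maximal solution blows up in `H¹⁰` at a finite time, where the `ℓ³`-free variant would bound it.
  - cyclic cancellation: used ONLY through energy monotonicity/flux ("funding", Step 3 below);
    without it steady supercritical states `X_n ≡ lam^{-n/5}/c` of `Ẋ_n = -lam^{4n/5}X_n + c lam^n X_n²`
    exist at every scale (unbounded `ℓ³`, so not a counterexample as such); a slow non-conservative
    front with self-funded long sojourns is the natural counterexample candidate to the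
    cancellation-free variant — plausible, not constructed (no closed form; feed-forward chains
    `Ẋ_n = -lam^{4n/5}X_n + c lam^{n-1}X_{n-1}²` respond instantaneously: `a_n ≈ (c'a_{n-1})^{2}`,
    giving decay or INSTANT loss of `H¹⁰`, never a finite-time blow-up).
  - symmetry (4.2): cosmetic (any quadratic form can be symmetrised) — "possibly unnecessary".
  - cutoff `X_{n<0} = 0`: gives finite energy and a finite low block; without it two-sided
    infinite-energy chains (perpetual pumps) enter; truth of that variant unknown, not needed.
  - `ℓ³ ↦ ℓ^q`: the argument below works for every `q < ∞` (`CircuitTraceLq`, expected TRUE); at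
    `q = ∞` (Type-I tier, `CircuitTraceLinfty`) it yields only the FROZEN-TRAIL statement and the
    variant is conjecturally FALSE (truncated `CircuitPump`; cf. the exogenous Type-I witness
    `Literature.Barriers.NavierStokesRegularity.TruncatedDyadic.Tao2016_prop51_typeI`).
* WHY IT RESISTS — every counterexample scenario tried dies on one of three structural facts,
  two of which are now lemmas here:
  (F1) ONE-SIDED COUPLING (`circuitRHS_eq_zero_of_vanishing_below`): every monomial driving scale
       `n` has a factor at a scale `≤ n`; `{X_{≤N} = 0}` is invariant, and by BACKWARD GRÖNWALL ON
       THE LOW BLOCK (`block_backward_gronwall`, `block_eq_zero_backward`; rates there are `≤ lam^N`,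
       no fine structure) a front can never pass tracelessly: what is below scale `N` at a later
       time controls what was there one local time unit earlier, up to a factor `e^{O(1)}`.
  (F2) FUNDING (`trilinear_cancel` ⇒ `dE_{≥b}/dt = -Σ_{n≥b} lam^{4n/5}|X_n|² + flux_b`,
       `|flux_b| ≤ m³K lam^{2b/5} a_{b-1}² a_b`, `E_{≥b} ≤ C_E lam^{-2b/5}` from `a ≤ M^{1/3}`):
       half-activity (`a ≥ δ₀/2`) anywhere in a band of scales `≥ ℓ` during a window `J` has
       measure `≤ Λ₁ lam^{-4ℓ/5} + |J|/2` (take the budget `D` scales deeper, where the maximal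
       influx `m³KM lam^{2(ℓ-D)/5}` is half the dissipation `(δ₀/2)² lam^{2ℓ/5}` of activity).
       Kills "slow/breathing fronts", "thick fronts" (width `≤ M/δ₀³` anyway) and "long sojourns".
  (F3) ε-REGULARITY / discrete maximum principle: with `K = max|coeff|`,
       `δ₀ := 1/(16 m² K lam⁴)`: if `sup_n a_n(t₀) ≤ δ₀` then `sup_n lam^{4n}|X_n|` is non-increasing
       after `t₀` (weights `θ^n`, `θ ↑ 1`, make the sup a max). So blow-up needs RECORDS: first
       activation times `t_n ↑` of every large scale `n` at level `δ₀`, and (growth at level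
       `≤ δ₀ ≪ 1/K` needs a neighbour at level `√(δ₀/8m²K) > δ₀` below or `1/(16m²K)` above, with
       positive measure `≥ c_G lam^{-4n/5}` during the rise from `δ₀/2`) activity propagates only
       between neighbours, through STRICTLY MORE active lower neighbours when the upper one is
       fresh.
* PROOF ARCHITECTURE this analysis suggests (for the provers; replaces the planner's sketch —
  no forward Type-I timing, no recentred limit, no compactness needed):
  1. (F3) ⇒ records `n → ∞`, `t_n < T`; scales `> n` are `< δ₀` before `t_n` and decay
     geometrically above the record (`a_{n+j} ≤ M^{1/3} 2^{-j}`, half-line max principle).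
  2. ENABLER CHAIN: from `(n, t_n)` go back through last up-crossings `[e,s]` of `[δ₀/2, δ₀]`;
     each rise interval is half-active (so `≤ 4Λ₁` local units long by (F2)) and contains an
     instant where the lower neighbour is `> δ₀` or the upper one is `> 1/(16m²K)` (never the
     fresh scale `n`). Consecutive chain intervals overlap, so while the chain stays in the band
     `[n-d+1, n-1]` the covered time span is half-active of FULL measure — (F2) forces the chain
     below `n-d+1` within `2Λ₁ lam^{-4(n-d+1)/5}`: scale `n-d` is active at some
     `u_d ∈ [t_n - C₁ lam^{-4(n-d)/5}, t_n]`, for every `1 ≤ d ≤ n - n₀` (TYPE-I PACING BACKWARD,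
     for free).
  3. (F1) quantitatively, in critical units with weights `θ^{(n-d)-q}` (`θ < 1`) on the block
     `q ≤ n-d` (Lipschitz constant `L' ≍ lam^{4(n-d)/5}`): `N_{n-d}(u_d) ≥ δ₀` ⇒
     `N_{n-d}(t_n) ≥ δ₀ e^{-L'(t_n-u_d)} ≥ ρ' > 0` ⇒ some `q_d ≤ n-d` with
     `a_{q_d}(t_n) ≥ ρ' θ^{-(n-d-q_d)}`; as `a ≤ M^{1/3}`, `n-d-q_d ≤ D'`, so at the single time
     `t_n` at least `(n-n₀)/(D'+1)` distinct scales carry amplitude `≥ ρ'` (FROZEN TRAIL THEOREM —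
     holds under the `ℓ^∞` bound alone).
  4. `ℓ³` (or any `ℓ^q`, `q < ∞`): `M ≥ Σ a(t_n)³ ≥ (n-n₀)ρ'³/(D'+1) → ∞`. Contradiction.
  Constants depend on `(lam, m, K, M)` only. The `H¹⁰` a-priori bound enters in 1 (suprema are
  maxima; initial inactivity of high scales) and in (F2) (termwise differentiation of `E_{≥b}`).
  What provers still have to build: the weighted/critical-unit version of `block_backward_gronwall`
  (same proof with `X̃_q = lam^{q/5}θ^{N-q}X_q`), the energy/flux identity for infinite sums from
  `trilinear_cancel`, the two maximum principles, and the measure-theoretic chain bookkeeping.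
* NATURAL STRENGTHENINGS: `CircuitTraceLq` (all `q < ∞`): expected true, same proof.
  `CircuitTraceLinfty`: expected FALSE (it is Type-I exclusion; the frozen-trail picture is exactly
  a Type-I DSS pump). Quantitative version (`C` depending on `lam, m, K, M, T` and the `H¹⁰` norm at
  one time `T' < T` only): plausible via the same constants. Dropping continuity at `t = 0`: harmless.

## Findings (cycle 2, 2026-08-16, gen-2 seat) — NO KILL; the lead's six stubs survive; two are now certified SHARP

Targets this cycle = the six stubs of the lead's reshaped skeleton `Lines/tilted-trace-gronwall.lean`
(`stub_valveBudget` S1 [lead], `stub_blockStaysQuiet` S2a, `stub_quietImpliesRegular` S2b,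
`stub_tiltedGronwall` S4, `stub_terminalTrace` S5, `stub_traceEndgame` S6). Verdicts (§7, with the
arguments): ALL SIX ARE TRUE AS TYPED as far as the disprover's arsenal reaches — every degenerate
instance (`m = 0`, `A < 0`, `Γ < 0`, `R < 0`, `T ≤ 0`, `t₁ = t₂`, any real `β` in S4) is vacuous or
harmless, quantifier order and casts are right, and each proof route closes on paper with explicit
constants (S1's constant shape is repaired w.r.t. cycle 1 §6: the cut-flux leak `O(δ²·a_{n+1})` is
absorbed by scale `n+1`'s own dissipation, leaving `O(δ⁴)`). Two NEW KERNEL-CHECKED NEGATIVE LEMMAS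
(§7; landing as `Theorems/CircuitTrace/Negative/ValveBudgetWithoutCyclic.lean` and
`Negative/TraceEndgameCriticalTilt.lean`):
* `Targets.valveBudget_false_without_cyclic`: S1 with `IsCyclic coeff →` deleted is FALSE (steady
  non-conservative Riccati mode `X_1 ≡ 1/2` at `lam = 32`: valve `0` quiet for ever, scale `1` active
  for ever). S1 is the ONLY stub assuming (4.3); it must genuinely use it (via `trilinear_cancel`).
* `Targets.traceEndgame_false_from_critical_tilt`: S6 with `1/5 < β` weakened to `1/5 ≤ β` is FALSE
  at `β = 1/5` (floor `X_0 ≡ 2` + pairwise-disjoint tent fronts `2^{-k}·tent(16^k(1-t))`, `lam = 32`,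
  `Γ = 2`, `δ = 1`, `R = 2`, `M = 8`, `T = 1`): in untilted critical units a finite mass parked at a low
  scale licenses arbitrarily fast collapse of fronts high up. So S6 is SHARP in the tilt, the
  composition's `β = 2/5` is a genuine choice, and S4 must deliver a strictly super-critical tilt
  (it claims every real `β`; checked on paper).

## Attack log (details in the refuter's NOTES.md)
formalisation loopholes (casts, rpow at `n<0`, `let F`, quantifier order, `m=0`, `coeff=0`,
equations at `n ≤ 0`) — none; decoupled conservative circuits (only `μ = none`): `|x|` decays
exactly (`⟨Q(x),x⟩=0`), regular; scalar `m=1` (KP): positive data globally regular (BMR, catalogue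
`DyadicCascadeRegularity`), signed data: no blow-up known at this dissipation strength; Tao's
`m=4` circuit: blows up (Thm 4.2) with `ℓ³ → ∞` (Type II) — consistent; exogenous Type-I witness
(Prop 5.1 endpoint): not autonomous, `ℓ^q ~ k^{1/q}` — consistent; DSS critical ansatz
`X_n = lam^{-n/5}φ(lam^{4n/5}(T-t))`: incompatible with the cutoff unless decoupled, then decays;
slow/breathing fronts, thick sub-threshold fronts, puffs from a low-scale reservoir, trail
re-absorption by backscatter — all excluded by (F1)–(F3) as above.
-/

noncomputable section

set_option linter.dupNamespace false

namespace Summit.NavierStokesRegularity.NavierStokesRegularity.Cruxes.CircuitTrace.Disproof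

open Finset Real Set
open Summit.NavierStokesRegularity.NavierStokesRegularity.Theses.PerpetualPump (CircuitTrace)
open Literature.Analysis.FluidPDE.TaoCascade

/-! ## §0 The circuit class, named -/

/-- The right-hand side `F_{i,n}(t)` of Tao's viscous circuit system (4.3)/(4.13) at `α = 2/5`,
exactly as inlined (`let F := …`) in `CircuitTrace`, `CircuitPump`, `PumpTransfer`:
`-lam^{4n/5} X_{i,n} + Σ_{i₁,i₂,μ} coeff(i₁,i₂,i,μ) lam^{n-μ₃} X_{i₁,n-μ₃+μ₁} X_{i₂,n-μ₃+μ₂}`,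
offsets `μ ∈ S = {(0,0,0),(1,0,0),(0,1,0),(0,0,1)}` labelled `none, some 0, some 1, some 2`. -/
def circuitRHS (lam : ℝ) {m : ℕ} (coeff : Fin m → Fin m → Fin m → Option (Fin 3) → ℝ)
    (X : Fin m → ℤ → ℝ → ℝ) (i : Fin m) (n : ℤ) (t : ℝ) : ℝ :=
  -(lam ^ ((4 / 5 : ℝ) * n)) * X i n t +
    ∑ i₁ : Fin m, ∑ i₂ : Fin m, ∑ μ : Option (Fin 3),
      coeff i₁ i₂ i μ * lam ^ ((n : ℝ) - (if μ = some 2 then 1 else 0)) *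
        X i₁ (n + ((if μ = some 0 then 1 else 0) - (if μ = some 2 then 1 else 0))) t *
        X i₂ (n + ((if μ = some 1 then 1 else 0) - (if μ = some 2 then 1 else 0))) t

/-- Tao's symmetry condition (4.2) in the `Option (Fin 3)` encoding. -/
def IsSymm {m : ℕ} (coeff : Fin m → Fin m → Fin m → Option (Fin 3) → ℝ) : Prop :=
  ∀ (i₁ i₂ i₃ : Fin m) (μ : Option (Fin 3)),
    coeff i₁ i₂ i₃ μ = coeff i₂ i₁ i₃ (Option.map (Equiv.swap (0 : Fin 3) 1) μ)

/-- Tao's cyclic cancellation condition (4.3) in the `Option (Fin 3)` encoding. -/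
def IsCyclic {m : ℕ} (coeff : Fin m → Fin m → Fin m → Option (Fin 3) → ℝ) : Prop :=
  ∀ (v : Fin 3 → Fin m) (μ : Option (Fin 3)),
    ∑ σ : Equiv.Perm (Fin 3), coeff (v (σ 0)) (v (σ 1)) (v (σ 2)) (Option.map σ.symm μ) = 0

/-- `CircuitTrace` restated through the named pieces (definitionally the route decl). -/
def CircuitTrace' : Prop :=
  ∀ lam : ℝ, 1 < lam → ∀ (m : ℕ) (coeff : Fin m → Fin m → Fin m → Option (Fin 3) → ℝ),
    IsSymm coeff → IsCyclic coeff → ∀ T : ℝ, 0 < T → ∀ X : Fin m → ℤ → ℝ → ℝ,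
    (∀ (i : Fin m) (n : ℤ), ContinuousOn (X i n) (Set.Ico 0 T)) →
    (∀ (i : Fin m) (n : ℤ), ∀ t ∈ Set.Ioo 0 T, HasDerivAt (X i n) (circuitRHS lam coeff X i n t) t) →
    (∀ (i : Fin m) (n : ℤ) (t : ℝ), n < 0 → X i n t = 0) →
    (∀ T' ∈ Set.Ioo 0 T, ∃ C : ℝ, ∀ (i : Fin m) (n : ℤ), ∀ t ∈ Set.Icc 0 T',
        lam ^ ((4 : ℝ) * n) * |X i n t| ≤ C) →
    (∃ M : ℝ, ∀ t ∈ Set.Ico 0 T, ∀ s : Finset ℤ,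
        ∑ n ∈ s, ∑ i : Fin m, (lam ^ ((1 / 5 : ℝ) * n) * |X i n t|) ^ 3 ≤ M) →
    ∃ C : ℝ, ∀ (i : Fin m) (n : ℤ), ∀ t ∈ Set.Ico 0 T, lam ^ ((4 : ℝ) * n) * |X i n t| ≤ C

theorem circuitTrace_iff : CircuitTrace ↔ CircuitTrace' := Iff.rfl

/-! ## §2 Non-vacuity: the class contains the classical scalar dyadic model and Tao-type circuits -/

/-- A combinatorial identity behind every cancellation check in the `Option (Fin 3)` encoding:
summing a function of `σ.symm a` over the six permutations of `Fin 3` counts every value twice. -/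
theorem sum_perm_symm_apply (f : Fin 3 → ℝ) (a : Fin 3) :
    ∑ σ : Equiv.Perm (Fin 3), f (σ.symm a) = 2 * ∑ b : Fin 3, f b := by
  -- the sum does not depend on `a`
  have hconst : ∀ a b : Fin 3,
      ∑ σ : Equiv.Perm (Fin 3), f (σ.symm a) = ∑ σ : Equiv.Perm (Fin 3), f (σ.symm b) := by
    intro a b
    rw [← Equiv.sum_comp (Equiv.mulLeft (Equiv.swap a b))]
    refine Finset.sum_congr rfl fun σ _ => ?_
    simp [Equiv.Perm.mul_def, Equiv.swap_apply_left]
  have h3 : (3 : ℝ) * ∑ σ : Equiv.Perm (Fin 3), f (σ.symm a)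
      = ∑ b : Fin 3, ∑ σ : Equiv.Perm (Fin 3), f (σ.symm b) := by
    rw [Finset.sum_congr rfl fun b _ => (hconst a b).symm, Finset.sum_const, Finset.card_univ,
      Fintype.card_fin, nsmul_eq_mul]
    norm_num
  have h6 : ∑ b : Fin 3, ∑ σ : Equiv.Perm (Fin 3), f (σ.symm b) = 6 * ∑ b : Fin 3, f b := by
    rw [Finset.sum_comm]
    have : ∀ σ : Equiv.Perm (Fin 3), ∑ b : Fin 3, f (σ.symm b) = ∑ b : Fin 3, f b := fun σ =>
      Equiv.sum_comp σ.symm f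
    rw [Finset.sum_congr rfl fun σ _ => this σ, Finset.sum_const, Finset.card_univ,
      Fintype.card_perm, Fintype.card_fin, nsmul_eq_mul]
    norm_num [Nat.factorial]
  linarith

/-- The Katz–Pavlović / Cheskidov–Friedlander scalar dyadic model with Tao's exponents,
`Ẋ_n = -lam^{4n/5} X_n + c lam^{n-1} X_{n-1}² - c lam^n X_n X_{n+1}`, as a member of the class
(4.3): `m = 1`, `coeff(some 2) = c` (forward transfer `X_{n-1}² → X_n`, offset `(0,0,1)`),
`coeff(some 0) = coeff(some 1) = -c/2` (its back-reaction, offsets `(1,0,0)`, `(0,1,0)`),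
`coeff(none) = 0`. -/
def kpCoeff (c : ℝ) : Fin 1 → Fin 1 → Fin 1 → Option (Fin 3) → ℝ :=
  fun _ _ _ μ => Option.elim μ 0 (fun a => if a = 2 then c else -c / 2)

theorem kpCoeff_symm (c : ℝ) : IsSymm (kpCoeff c) := by
  intro i₁ i₂ i₃ μ
  rcases μ with _ | a
  · rfl
  · fin_cases a <;> simp [kpCoeff, Equiv.swap_apply_def]

theorem kpCoeff_cyclic (c : ℝ) : IsCyclic (kpCoeff c) := by
  intro v μ
  rcases μ with _ | a
  · simp [kpCoeff]
  · have := sum_perm_symm_apply (fun b : Fin 3 => if b = 2 then c else -c / 2) a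
    have key : ∀ σ : Equiv.Perm (Fin 3),
        kpCoeff c (v (σ 0)) (v (σ 1)) (v (σ 2)) (Option.map σ.symm (some a)) =
          (if σ.symm a = 2 then c else -c / 2) := fun σ => rfl
    rw [Finset.sum_congr rfl (fun σ _ => key σ), this, Fin.sum_univ_three]
    simp only [Fin.isValue, show ((0 : Fin 3) = 2) = False by decide,
      show ((1 : Fin 3) = 2) = False by decide, ite_false, ite_true]
    ring

/-- With the scalar coefficients the circuit right-hand side is the familiar dyadic model. -/
theorem circuitRHS_kpCoeff (lam c : ℝ) (X : Fin 1 → ℤ → ℝ → ℝ) (n : ℤ) (t : ℝ) :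
    circuitRHS lam (kpCoeff c) X 0 n t =
      -(lam ^ ((4 / 5 : ℝ) * n)) * X 0 n t + (c * lam ^ ((n : ℝ) - 1) * X 0 (n - 1) t * X 0 (n - 1) t
        - c * lam ^ (n : ℝ) * X 0 n t * X 0 (n + 1) t) := by
  unfold circuitRHS kpCoeff
  simp [Fintype.sum_option, Fin.sum_univ_three]
  ring

/-! ## §3 Structure any counterexample must beat (helper lemmas for both sides) -/

/-- ONE-SIDED COUPLING (support invariance). Every interaction driving scale `n` contains a factor
at a scale `≤ n` (offsets `(0,0,0)`: `X_n X_n`; `(1,0,0)`,`(0,1,0)`: `X_{n+1} X_n`; `(0,0,1)`: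
`X_{n-1} X_{n-1}`). Hence if all modes at scales `≤ n` vanish at time `t`, then `F_{i,n'}(t) = 0`
for every `n' ≤ n`: the subspace `{X_{≤ n} = 0}` is invariant under the flow, in both time
directions wherever uniqueness holds (see `block_backward_gronwall`). A traceless transfer that
EMPTIES the scales `≤ n` at a finite time is therefore impossible — the exact obstruction the
recentring argument for `CircuitTrace` exploits. -/
theorem circuitRHS_eq_zero_of_vanishing_below (lam : ℝ) {m : ℕ}
    (coeff : Fin m → Fin m → Fin m → Option (Fin 3) → ℝ) (X : Fin m → ℤ → ℝ → ℝ) (i : Fin m)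
    (n : ℤ) (t : ℝ) (h : ∀ (i' : Fin m) (n' : ℤ), n' ≤ n → X i' n' t = 0) :
    circuitRHS lam coeff X i n t = 0 := by
  unfold circuitRHS
  rw [h i n le_rfl, mul_zero, zero_add]
  refine Finset.sum_eq_zero fun i₁ _ => Finset.sum_eq_zero fun i₂ _ =>
    Finset.sum_eq_zero fun μ _ => ?_
  rcases μ with _ | a
  · simp [h i₁ n le_rfl]
  · fin_cases a
    · simp [h i₂ n le_rfl]
    · simp [h i₁ n le_rfl]
    · have h' : X i₁ (n + -1) t = 0 := h i₁ _ (by linarith)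
      simp [h']

/-! ## §1 Load-bearing hypotheses: what happens when one is deleted -/

/-- With all structure constants zero the circuit is the decoupled linear heat flow
`Ẋ_{i,n} = -lam^{4n/5} X_{i,n}`. -/
theorem circuitRHS_zero_coeff (lam : ℝ) {m : ℕ} (X : Fin m → ℤ → ℝ → ℝ) (i : Fin m) (n : ℤ)
    (t : ℝ) : circuitRHS lam (fun _ _ _ _ => 0) X i n t = -(lam ^ ((4 / 5 : ℝ) * n)) * X i n t := by
  simp [circuitRHS]

theorem isSymm_zero {m : ℕ} : IsSymm (fun (_ _ _ : Fin m) (_ : Option (Fin 3)) => (0 : ℝ)) :=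
  fun _ _ _ _ => rfl

theorem isCyclic_zero {m : ℕ} : IsCyclic (fun (_ _ _ : Fin m) (_ : Option (Fin 3)) => (0 : ℝ)) :=
  fun _ _ => by simp

/-- `CircuitTrace` with the a-priori regularity hypothesis
`∀ T' < T, sup_{i,n,t ≤ T'} lam^{4n}|X_{i,n}(t)| < ∞` DELETED (everything else verbatim). -/
def CircuitTraceWithoutApriori : Prop :=
  ∀ lam : ℝ, 1 < lam → ∀ (m : ℕ) (coeff : Fin m → Fin m → Fin m → Option (Fin 3) → ℝ),
    IsSymm coeff → IsCyclic coeff → ∀ T : ℝ, 0 < T → ∀ X : Fin m → ℤ → ℝ → ℝ,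
    (∀ (i : Fin m) (n : ℤ), ContinuousOn (X i n) (Set.Ico 0 T)) →
    (∀ (i : Fin m) (n : ℤ), ∀ t ∈ Set.Ioo 0 T, HasDerivAt (X i n) (circuitRHS lam coeff X i n t) t) →
    (∀ (i : Fin m) (n : ℤ) (t : ℝ), n < 0 → X i n t = 0) →
    (∃ M : ℝ, ∀ t ∈ Set.Ico 0 T, ∀ s : Finset ℤ,
        ∑ n ∈ s, ∑ i : Fin m, (lam ^ ((1 / 5 : ℝ) * n) * |X i n t|) ^ 3 ≤ M) →
    ∃ C : ℝ, ∀ (i : Fin m) (n : ℤ), ∀ t ∈ Set.Ico 0 T, lam ^ ((4 : ℝ) * n) * |X i n t| ≤ C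

/-- The rough linear witness: `X_n(t) = 2^{-3n} e^{-2^{4n/5} t}` for `n ≥ 0`, zero below.
It solves the decoupled heat flow (`lam = 2`, `coeff = 0`), has `ℓ³`-critical norm `≤ 2`
(indeed `(2^{n/5} X_n)^3 ≤ 2^{-42n/5}`), but `2^{4n} X_n(0) = 2^n` is unbounded: its datum is in
the critical space and not in `H¹⁰`. -/
def roughWitness (n : ℤ) (t : ℝ) : ℝ :=
  if 0 ≤ n then (2 : ℝ) ^ (-(3 : ℝ) * n) * Real.exp (-((2 : ℝ) ^ ((4 / 5 : ℝ) * n)) * t) else 0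

theorem roughWitness_of_neg {n : ℤ} (hn : n < 0) (t : ℝ) : roughWitness n t = 0 := by
  simp [roughWitness, not_le.mpr hn]

theorem roughWitness_of_nonneg {n : ℤ} (hn : 0 ≤ n) :
    roughWitness n = fun t => (2 : ℝ) ^ (-(3 : ℝ) * n) * Real.exp (-((2 : ℝ) ^ ((4 / 5 : ℝ) * n)) * t) := by
  funext t; simp [roughWitness, hn]

theorem continuous_roughWitness (n : ℤ) : Continuous (roughWitness n) := by
  by_cases hn : 0 ≤ n
  · rw [roughWitness_of_nonneg hn]; fun_prop
  · have : roughWitness n = fun _ => 0 := funext fun t => roughWitness_of_neg (not_le.mp hn) t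
    rw [this]; exact continuous_const

theorem hasDerivAt_roughWitness (n : ℤ) (t : ℝ) :
    HasDerivAt (roughWitness n) (-((2 : ℝ) ^ ((4 / 5 : ℝ) * n)) * roughWitness n t) t := by
  by_cases hn : 0 ≤ n
  · have key : HasDerivAt
        (fun s : ℝ => (2 : ℝ) ^ (-(3 : ℝ) * n) * Real.exp (-((2 : ℝ) ^ ((4 / 5 : ℝ) * n)) * s))
        (-((2 : ℝ) ^ ((4 / 5 : ℝ) * n)) *
          ((2 : ℝ) ^ (-(3 : ℝ) * n) * Real.exp (-((2 : ℝ) ^ ((4 / 5 : ℝ) * n)) * t))) t := by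
      have h1 : HasDerivAt (fun s : ℝ => -((2 : ℝ) ^ ((4 / 5 : ℝ) * n)) * s)
          (-((2 : ℝ) ^ ((4 / 5 : ℝ) * n))) t := by
        simpa using (hasDerivAt_id t).const_mul (-((2 : ℝ) ^ ((4 / 5 : ℝ) * n)))
      have h2 := (h1.exp).const_mul ((2 : ℝ) ^ (-(3 : ℝ) * n))
      convert h2 using 1
      all_goals (try rfl)
      ring
    rw [roughWitness_of_nonneg hn]
    exact key
  · have : roughWitness n = fun _ => 0 := funext fun t => roughWitness_of_neg (not_le.mp hn) t
    rw [this]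
    simpa using hasDerivAt_const t (0 : ℝ)

/-- The critical `ℓ³` summand of the witness at scale `n = k ≥ 0` is at most `(1/2)^k`. -/
theorem roughWitness_term_le (k : ℕ) {t : ℝ} (ht : 0 ≤ t) :
    ((2 : ℝ) ^ ((1 / 5 : ℝ) * (k : ℤ)) * |roughWitness k t|) ^ 3 ≤ (1 / 2 : ℝ) ^ k := by
  have hn : (0 : ℤ) ≤ k := Int.natCast_nonneg k
  rw [roughWitness_of_nonneg hn]
  simp only [Int.cast_natCast]
  have h2 : (0 : ℝ) < 2 := by norm_num
  set r : ℝ := (2 : ℝ) ^ ((4 / 5 : ℝ) * k) with hr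
  have hexp : Real.exp (-r * t) ≤ 1 := by
    rw [Real.exp_le_one_iff]
    have : 0 ≤ r := (Real.rpow_pos_of_pos h2 _).le
    nlinarith
  have hexp0 : 0 ≤ Real.exp (-r * t) := (Real.exp_pos _).le
  have hA : 0 ≤ (2 : ℝ) ^ (-(3 : ℝ) * k) := (Real.rpow_pos_of_pos h2 _).le
  have hB : 0 ≤ (2 : ℝ) ^ ((1 / 5 : ℝ) * k) := (Real.rpow_pos_of_pos h2 _).le
  rw [abs_of_nonneg (mul_nonneg hA hexp0)]
  -- the base is at most 2^{-(14/5) k}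
  have hbase : (2 : ℝ) ^ ((1 / 5 : ℝ) * k) * ((2 : ℝ) ^ (-(3 : ℝ) * k) * Real.exp (-r * t))
      ≤ (2 : ℝ) ^ (-(14 / 5 : ℝ) * k) := by
    calc (2 : ℝ) ^ ((1 / 5 : ℝ) * k) * ((2 : ℝ) ^ (-(3 : ℝ) * k) * Real.exp (-r * t))
        = (2 : ℝ) ^ (-(14 / 5 : ℝ) * k) * Real.exp (-r * t) := by
          rw [← mul_assoc, ← Real.rpow_add h2]; ring_nf
      _ ≤ (2 : ℝ) ^ (-(14 / 5 : ℝ) * k) * 1 :=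
          mul_le_mul_of_nonneg_left hexp (Real.rpow_pos_of_pos h2 _).le
      _ = _ := mul_one _
  have hbase0 : 0 ≤ (2 : ℝ) ^ ((1 / 5 : ℝ) * k) * ((2 : ℝ) ^ (-(3 : ℝ) * k) * Real.exp (-r * t)) :=
    mul_nonneg hB (mul_nonneg hA hexp0)
  calc ((2 : ℝ) ^ ((1 / 5 : ℝ) * k) * ((2 : ℝ) ^ (-(3 : ℝ) * k) * Real.exp (-r * t))) ^ 3
      ≤ ((2 : ℝ) ^ (-(14 / 5 : ℝ) * k)) ^ 3 := by gcongr
    _ = (2 : ℝ) ^ (-(42 / 5 : ℝ) * k) := by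
        rw [← Real.rpow_natCast, ← Real.rpow_mul h2.le]; ring_nf
    _ ≤ (2 : ℝ) ^ (-(k : ℝ)) := by
        apply Real.rpow_le_rpow_of_exponent_le (by norm_num)
        have : (0 : ℝ) ≤ k := Nat.cast_nonneg k
        nlinarith
    _ = (1 / 2 : ℝ) ^ k := by
        rw [Real.rpow_neg h2.le, Real.rpow_natCast, one_div, inv_pow]

/-- The comparison series: `(1/2)^n` on `n ≥ 0`, zero below; it sums to `2`. -/
def halfGeom (n : ℤ) : ℝ := if 0 ≤ n then (1 / 2 : ℝ) ^ n.toNat else 0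

theorem hasSum_halfGeom : HasSum halfGeom 2 := by
  have h1 : HasSum (fun k : ℕ => halfGeom k) 2 := by
    have : (fun k : ℕ => halfGeom k) = fun k : ℕ => (1 / 2 : ℝ) ^ k := by
      funext k; simp [halfGeom]
    rw [this]; exact hasSum_geometric_two
  have h2 : HasSum (fun k : ℕ => halfGeom (-((k : ℤ) + 1))) 0 := by
    have : (fun k : ℕ => halfGeom (-((k : ℤ) + 1))) = fun _ => 0 := by
      funext k
      have hk : ¬ (0 : ℤ) ≤ -((k : ℤ) + 1) := by omega
      unfold halfGeom
      rw [if_neg hk]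
    rw [this]; exact hasSum_zero
  simpa using HasSum.of_nat_of_neg_add_one (f := halfGeom) h1 h2

theorem halfGeom_nonneg (n : ℤ) : 0 ≤ halfGeom n := by
  unfold halfGeom; split_ifs <;> positivity

theorem roughWitness_term_le_halfGeom (n : ℤ) {t : ℝ} (ht : 0 ≤ t) :
    ((2 : ℝ) ^ ((1 / 5 : ℝ) * n) * |roughWitness n t|) ^ 3 ≤ halfGeom n := by
  by_cases hn : 0 ≤ n
  · obtain ⟨k, rfl⟩ := Int.eq_ofNat_of_zero_le hn
    have := roughWitness_term_le k ht
    simpa [halfGeom] using this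
  · rw [roughWitness_of_neg (not_le.mp hn)]
    simp [halfGeom, hn]

/-- The `ℓ³`-critical norm of the witness is at most `2` at all times `t ≥ 0`. -/
theorem roughWitness_l3_le (t : ℝ) (ht : 0 ≤ t) (s : Finset ℤ) :
    ∑ n ∈ s, ∑ _i : Fin 1, ((2 : ℝ) ^ ((1 / 5 : ℝ) * n) * |roughWitness n t|) ^ 3 ≤ 2 := by
  calc ∑ n ∈ s, ∑ _i : Fin 1, ((2 : ℝ) ^ ((1 / 5 : ℝ) * n) * |roughWitness n t|) ^ 3
      = ∑ n ∈ s, ((2 : ℝ) ^ ((1 / 5 : ℝ) * n) * |roughWitness n t|) ^ 3 := by simp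
    _ ≤ ∑ n ∈ s, halfGeom n := Finset.sum_le_sum fun n _ => roughWitness_term_le_halfGeom n ht
    _ ≤ 2 := sum_le_hasSum s (fun n _ => halfGeom_nonneg n) hasSum_halfGeom

/-- **The a-priori `H¹⁰` hypothesis is load-bearing** (in the weak sense that the DATUM must be
regular): without it the decoupled linear flow from the rough critical datum `2^{-3n}` is a
counterexample — `ℓ³`-critical norm `≤ 2` for all time, `sup_n 2^{4n}|X_n(0)| = sup_n 2^n = ∞`.
So `CircuitTrace` is a CONTINUATION criterion, not a regularity criterion for rough solutions; any
proof must use the `H¹⁰` bound on `[0,T']` (it is what makes the energy/flux sums converge and the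
supremum in the maximum principle attained). -/
theorem circuitTrace_false_without_apriori : ¬ CircuitTraceWithoutApriori := by
  intro h
  have hX := h 2 (by norm_num) 1 (fun _ _ _ _ => 0) isSymm_zero isCyclic_zero 1 one_pos
    (fun _ n t => roughWitness n t)
    (fun _ n => (continuous_roughWitness n).continuousOn)
    (fun i n t _ => by rw [circuitRHS_zero_coeff]; exact hasDerivAt_roughWitness n t)
    (fun _ n t hn => roughWitness_of_neg hn t)
    ⟨2, fun t ht s => roughWitness_l3_le t ht.1 s⟩
  obtain ⟨C, hC⟩ := hX
  -- evaluate at t = 0 and the scale k = ⌈C⌉₊ + 1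
  set k : ℕ := ⌈C⌉₊ + 1 with hk
  have h0 : (0 : ℝ) ∈ Set.Ico (0 : ℝ) 1 := ⟨le_rfl, one_pos⟩
  have hle := hC 0 (k : ℤ) 0 h0
  have h2 : (0 : ℝ) < 2 := by norm_num
  have hval : (2 : ℝ) ^ ((4 : ℝ) * ((k : ℤ) : ℝ)) * |roughWitness k 0| = (2 : ℝ) ^ (k : ℝ) := by
    rw [roughWitness_of_nonneg (Int.natCast_nonneg k)]
    simp only [Int.cast_natCast, mul_zero, Real.exp_zero, mul_one]
    rw [abs_of_nonneg (Real.rpow_pos_of_pos h2 _).le, ← Real.rpow_add h2]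
    ring_nf
  rw [hval, Real.rpow_natCast] at hle
  have hlt : (C : ℝ) < k := by
    have := Nat.le_ceil C
    push_cast [hk]
    linarith
  have hpow : (k : ℝ) < (2 : ℝ) ^ k := by exact_mod_cast Nat.lt_two_pow_self
  linarith

/-- ENERGY CONSERVATION OF THE NONLINEARITY — the algebraic core, in the `Option (Fin 3)`
encoding. For amplitudes `Y` (scale `n`) and `Z` (scale `n+1`) the trilinear expression collecting
ALL interactions with base scale `n`,
`Σ_{v : Fin 3 → Fin m} Σ_μ coeff(v₀,v₁,v₂,μ) · Π_a W^{(a)}_μ(v_a)`, `W^{(a)}_μ = Z` if `μ = some a`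
and `Y` otherwise, vanishes under (cyclic): the orbits of `S₃` acting by
`(v, μ) ↦ (v ∘ σ, σ⁻¹·μ)` have constant monomial, and (cyclic) says each orbit sum of `coeff` is
zero. Consequence (for sums that converge absolutely, e.g. under the a-priori `H¹⁰` bound or for
finitely supported states): `Σ_{i,n} X_{i,n}·(F_{i,n} + lam^{4n/5}X_{i,n}) = 0`, i.e.
`d/dt ½ΣX² = -Σ_n lam^{4n/5}|X_n|²`, and the energy flux from scales `≤ b` to scales `≥ b+1` is
the `μ = some 2` part at base `b` alone, `lam^b Σ coeff(i₁,i₂,i₃,some 2) X_{i₁,b}X_{i₂,b}X_{i₃,b+1}`,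
of size `≤ K lam^{2b/5} a_b² a_{b+1}` in critical units `a_n = lam^{n/5}|X_n|` — the FUNDING
bound used in §5 of the module docstring. -/
theorem trilinear_cancel {m : ℕ} {coeff : Fin m → Fin m → Fin m → Option (Fin 3) → ℝ}
    (hcyc : IsCyclic coeff) (Y Z : Fin m → ℝ) :
    ∑ v : Fin 3 → Fin m, ∑ μ : Option (Fin 3),
      coeff (v 0) (v 1) (v 2) μ * ∏ a : Fin 3, (if μ = some a then Z else Y) (v a) = 0 := by
  set P : (Fin 3 → Fin m) → Option (Fin 3) → ℝ :=
    fun v μ => ∏ a : Fin 3, (if μ = some a then Z else Y) (v a) with hPdef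
  have hP : ∀ (σ : Equiv.Perm (Fin 3)) (v : Fin 3 → Fin m) (μ : Option (Fin 3)),
      P (v ∘ σ) (Option.map σ.symm μ) = P v μ := by
    intro σ v μ
    simp only [hPdef, Function.comp_apply]
    rw [← Equiv.prod_comp σ (fun b => (if μ = some b then Z else Y) (v b))]
    refine Finset.prod_congr rfl fun a _ => ?_
    rcases μ with _ | b
    · simp
    · have : (Option.map (⇑σ.symm) (some b) = some a) = (some b = some (σ a)) := by
        rw [Option.map_some, Option.some.injEq, Option.some.injEq, eq_iff_iff]
        exact Equiv.symm_apply_eq σ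
      simp only [this]
  change ∑ v : Fin 3 → Fin m, ∑ μ : Option (Fin 3), coeff (v 0) (v 1) (v 2) μ * P v μ = 0
  set S := ∑ v : Fin 3 → Fin m, ∑ μ : Option (Fin 3), coeff (v 0) (v 1) (v 2) μ * P v μ with hS
  have hSσ : ∀ σ : Equiv.Perm (Fin 3),
      S = ∑ v : Fin 3 → Fin m, ∑ μ : Option (Fin 3),
        coeff (v (σ 0)) (v (σ 1)) (v (σ 2)) (Option.map σ.symm μ) * P v μ := by
    intro σ
    rw [hS, ← Equiv.sum_comp (σ.symm.arrowCongr (Equiv.refl (Fin m)))]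
    refine Finset.sum_congr rfl fun v _ => ?_
    rw [← Equiv.sum_comp (Equiv.optionCongr σ.symm)]
    refine Finset.sum_congr rfl fun μ _ => ?_
    have hv : (σ.symm.arrowCongr (Equiv.refl (Fin m))) v = v ∘ σ := rfl
    rw [hv, Equiv.optionCongr_apply, hP σ v μ]
    rfl
  have h6 : (6 : ℝ) * S = 0 := by
    have : ∑ _σ : Equiv.Perm (Fin 3), S = 6 * S := by
      rw [Finset.sum_const, Finset.card_univ, Fintype.card_perm, Fintype.card_fin, nsmul_eq_mul]
      norm_num [Nat.factorial]
    rw [← this, Finset.sum_congr rfl fun σ _ => hSσ σ, Finset.sum_comm]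
    refine Finset.sum_eq_zero fun v _ => ?_
    rw [Finset.sum_comm]
    refine Finset.sum_eq_zero fun μ _ => ?_
    rw [← Finset.sum_mul, hcyc v μ, zero_mul]
  linarith

/-- Size of the circuit vector field on the block of scales `0 ≤ n ≤ N`: linear in the block
amplitude `W`, with a Lipschitz constant `lam^N (1 + 4 m² K B)` governed by the LOW rates
`lam^{4n/5} ≤ lam^N` and a bound `B` on the neighbouring amplitudes (scales `≤ N+1`). Every
quadratic monomial has one factor at a scale `≤ n ≤ N` (`circuitRHS_eq_zero_of_vanishing_below`),
which is what makes the estimate linear in `W`. -/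
theorem circuitRHS_abs_le {lam : ℝ} (hlam : 1 ≤ lam) {m : ℕ}
    (coeff : Fin m → Fin m → Fin m → Option (Fin 3) → ℝ) {K : ℝ} (hK0 : 0 ≤ K)
    (hK : ∀ i₁ i₂ i₃ μ, |coeff i₁ i₂ i₃ μ| ≤ K) (X : Fin m → ℤ → ℝ → ℝ) (t : ℝ) {N : ℕ} {n : ℤ}
    (hn0 : 0 ≤ n) (hnN : n ≤ N) {B W : ℝ} (hB0 : 0 ≤ B) (hW0 : 0 ≤ W)
    (hB : ∀ (i : Fin m) (n' : ℤ), n' ≤ N + 1 → |X i n' t| ≤ B)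
    (hW : ∀ (i : Fin m) (n' : ℤ), n' ≤ N → |X i n' t| ≤ W) (i : Fin m) :
    |circuitRHS lam coeff X i n t| ≤ lam ^ (N : ℝ) * (1 + 4 * (m : ℝ) ^ 2 * K * B) * W := by
  have hlampos : 0 < lam := by linarith
  have hpowN : ∀ e : ℝ, e ≤ N → lam ^ e ≤ lam ^ (N : ℝ) := fun e he =>
    Real.rpow_le_rpow_of_exponent_le hlam he
  have hlamN0 : 0 ≤ lam ^ (N : ℝ) := (Real.rpow_pos_of_pos hlampos _).le
  have hnR : (n : ℝ) ≤ N := by exact_mod_cast hnN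
  have hn0R : (0 : ℝ) ≤ n := by exact_mod_cast hn0
  -- linear part
  have hlin : |-(lam ^ ((4 / 5 : ℝ) * n)) * X i n t| ≤ lam ^ (N : ℝ) * W := by
    rw [abs_mul, abs_neg, abs_of_nonneg (Real.rpow_pos_of_pos hlampos _).le]
    exact mul_le_mul (hpowN _ (by nlinarith)) (hW i n hnN) (abs_nonneg _) hlamN0
  -- generic four-factor bound
  have key : ∀ (a b c d A C D : ℝ), |a| ≤ A → b ≤ lam ^ (N : ℝ) → |c| ≤ C → |d| ≤ D → 0 ≤ b →
      0 ≤ A → 0 ≤ C → |a| * b * |c| * |d| ≤ A * lam ^ (N : ℝ) * C * D := by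
    intro a b c d A C D ha hb hc hd hb0 hA0 hC0
    have h1 : |a| * b ≤ A * lam ^ (N : ℝ) := mul_le_mul ha hb hb0 hA0
    have h2 : |a| * b * |c| ≤ A * lam ^ (N : ℝ) * C :=
      mul_le_mul h1 hc (abs_nonneg _) (mul_nonneg hA0 hlamN0)
    exact mul_le_mul h2 hd (abs_nonneg _) (mul_nonneg (mul_nonneg hA0 hlamN0) hC0)
  -- quadratic part, termwise
  have hterm : ∀ (i₁ i₂ : Fin m) (μ : Option (Fin 3)),
      |coeff i₁ i₂ i μ * lam ^ ((n : ℝ) - (if μ = some 2 then 1 else 0)) *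
        X i₁ (n + ((if μ = some 0 then 1 else 0) - (if μ = some 2 then 1 else 0))) t *
        X i₂ (n + ((if μ = some 1 then 1 else 0) - (if μ = some 2 then 1 else 0))) t|
        ≤ K * lam ^ (N : ℝ) * B * W := by
    intro i₁ i₂ μ
    rw [abs_mul, abs_mul, abs_mul, abs_of_nonneg (Real.rpow_pos_of_pos hlampos _).le]
    have hc := hK i₁ i₂ i μ
    rcases μ with _ | a
    · simp only [reduceCtorEq, ite_false, sub_zero, add_zero]
      exact key _ _ _ _ _ _ _ hc (hpowN _ hnR) (hB i₁ n (by linarith)) (hW i₂ n hnN)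
        (Real.rpow_pos_of_pos hlampos _).le hK0 hB0
    · fin_cases a
      · simp only [Fin.zero_eta, Fin.isValue, Option.some.injEq, Fin.reduceEq, ite_false,
          sub_zero, ite_true, add_zero]
        exact key _ _ _ _ _ _ _ hc (hpowN _ hnR) (hB i₁ (n + 1) (by linarith)) (hW i₂ n hnN)
          (Real.rpow_pos_of_pos hlampos _).le hK0 hB0
      · simp only [Fin.mk_one, Fin.isValue, Option.some.injEq, Fin.reduceEq, ite_false,
          sub_zero, add_zero, ite_true]
        calc |coeff i₁ i₂ i (some 1)| * lam ^ (n : ℝ) * |X i₁ n t| * |X i₂ (n + 1) t|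
            ≤ K * lam ^ (N : ℝ) * W * B :=
              key _ _ _ _ _ _ _ hc (hpowN _ hnR) (hW i₁ n hnN) (hB i₂ (n + 1) (by linarith))
                (Real.rpow_pos_of_pos hlampos _).le hK0 hW0
          _ = K * lam ^ (N : ℝ) * B * W := by ring
      · simp only [Fin.reduceFinMk, Fin.isValue, ite_true, Option.some.injEq, Fin.reduceEq,
          ite_false, zero_sub]
        have h1 : (n : ℝ) - 1 ≤ N := by linarith
        exact key _ _ _ _ _ _ _ hc (hpowN _ h1) (hB i₁ (n + -1) (by linarith))
          (hW i₂ (n + -1) (by linarith)) (Real.rpow_pos_of_pos hlampos _).le hK0 hB0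
  have hquad : |∑ i₁ : Fin m, ∑ i₂ : Fin m, ∑ μ : Option (Fin 3),
      coeff i₁ i₂ i μ * lam ^ ((n : ℝ) - (if μ = some 2 then 1 else 0)) *
        X i₁ (n + ((if μ = some 0 then 1 else 0) - (if μ = some 2 then 1 else 0))) t *
        X i₂ (n + ((if μ = some 1 then 1 else 0) - (if μ = some 2 then 1 else 0))) t|
        ≤ 4 * (m : ℝ) ^ 2 * K * lam ^ (N : ℝ) * B * W := by
    refine (Finset.abs_sum_le_sum_abs _ _).trans ?_
    refine (Finset.sum_le_sum fun i₁ _ => Finset.abs_sum_le_sum_abs _ _).trans ?_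
    refine (Finset.sum_le_sum fun i₁ _ => Finset.sum_le_sum fun i₂ _ =>
      Finset.abs_sum_le_sum_abs _ _).trans ?_
    refine (Finset.sum_le_sum fun i₁ _ => Finset.sum_le_sum fun i₂ _ =>
      Finset.sum_le_sum fun μ _ => hterm i₁ i₂ μ).trans ?_
    simp only [Finset.sum_const, Finset.card_univ, Fintype.card_option, Fintype.card_fin,
      nsmul_eq_mul]
    push_cast
    nlinarith [sq_nonneg (m : ℝ)]
  unfold circuitRHS
  refine (abs_add_le _ _).trans ?_
  have : lam ^ (N : ℝ) * W + 4 * (m : ℝ) ^ 2 * K * lam ^ (N : ℝ) * B * W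
      = lam ^ (N : ℝ) * (1 + 4 * (m : ℝ) ^ 2 * K * B) * W := by ring
  linarith

/-- **BACKWARD UNIQUENESS / GRÖNWALL FOR THE LOW BLOCK** (the formal kernel of the planner's
flagged gap "backward uniqueness of the chain at blow-up"). For a solution of the circuit on
`[t₀, t₁]` with no modes below scale `0` and amplitudes `≤ B` on the scales `≤ N+1`, the block
`(X_{i,n})_{0 ≤ n ≤ N}` obeys `|X_{i,n}(t)| ≤ δ · exp(L (t₁ - t))` whenever it is `≤ δ` at the
LATER time `t₁`, with `L = lam^N (1 + 4 m² K B)`. In particular (δ = 0) the block cannot be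
emptied in finite time unless it was always empty: a front cannot pass tracelessly. The rates of
the low block are bounded (`≤ lam^N`), so no fine structure is needed — only one-sided coupling
(`circuitRHS_abs_le`). For the recentred two-sided limit objects of the `CircuitTrace` argument,
provers need the same estimate with geometric weights `θ^{N-n}` on an infinite block `n ≤ N`
(same proof, `L ↦ L(1 + θ⁻¹)`), or — cheaper — apply THIS lemma to the recentred solutions before
passing to the limit. -/
theorem block_backward_gronwall {lam : ℝ} (hlam : 1 ≤ lam) {m : ℕ}
    (coeff : Fin m → Fin m → Fin m → Option (Fin 3) → ℝ) {K : ℝ} (hK0 : 0 ≤ K)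
    (hK : ∀ i₁ i₂ i₃ μ, |coeff i₁ i₂ i₃ μ| ≤ K) (X : Fin m → ℤ → ℝ → ℝ) {t₀ t₁ : ℝ}
    (N : ℕ)
    (hderiv : ∀ (i : Fin m) (n : ℤ), ∀ t ∈ Set.Icc t₀ t₁,
      HasDerivAt (X i n) (circuitRHS lam coeff X i n t) t)
    (hcut : ∀ (i : Fin m) (n : ℤ) (t : ℝ), n < 0 → X i n t = 0)
    {B : ℝ} (hB0 : 0 ≤ B)
    (hB : ∀ (i : Fin m) (n : ℤ), n ≤ N + 1 → ∀ t ∈ Set.Icc t₀ t₁, |X i n t| ≤ B)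
    {δ : ℝ} (hδ0 : 0 ≤ δ) (hδ : ∀ (i : Fin m) (n : ℤ), 0 ≤ n → n ≤ N → |X i n t₁| ≤ δ) :
    ∀ (i : Fin m) (n : ℤ), 0 ≤ n → n ≤ N → ∀ t ∈ Set.Icc t₀ t₁,
      |X i n t| ≤ δ * Real.exp (lam ^ (N : ℝ) * (1 + 4 * (m : ℝ) ^ 2 * K * B) * (t₁ - t)) := by
  set L := lam ^ (N : ℝ) * (1 + 4 * (m : ℝ) ^ 2 * K * B) with hL
  have hlampos : 0 < lam := by linarith
  have hL0 : 0 ≤ L := by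
    have : 0 ≤ lam ^ (N : ℝ) := (Real.rpow_pos_of_pos hlampos _).le
    have : 0 ≤ 4 * (m : ℝ) ^ 2 * K * B := by positivity
    rw [hL]; nlinarith
  -- the block as a curve in the sup-normed space `Fin m × Fin (N+1) → ℝ`
  set w : ℝ → (Fin m × Fin (N + 1) → ℝ) := fun t p => X p.1 ((p.2 : ℕ) : ℤ) t with hw
  set w' : ℝ → (Fin m × Fin (N + 1) → ℝ) :=
    fun t p => circuitRHS lam coeff X p.1 ((p.2 : ℕ) : ℤ) t with hw'
  have hwd : ∀ t ∈ Set.Icc t₀ t₁, HasDerivAt w (w' t) t := fun t ht =>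
    hasDerivAt_pi.2 fun p => hderiv p.1 _ t ht
  have hcomp : ∀ (t : ℝ) (i : Fin m) (n : ℤ), 0 ≤ n → n ≤ N → |X i n t| ≤ ‖w t‖ := by
    intro t i n h0 hN
    obtain ⟨k, rfl⟩ := Int.eq_ofNat_of_zero_le h0
    have hk : k < N + 1 := by omega
    have := norm_le_pi_norm (w t) (i, ⟨k, hk⟩)
    simpa [hw, Real.norm_eq_abs] using this
  have hlow : ∀ (t : ℝ) (i : Fin m) (n : ℤ), n ≤ N → |X i n t| ≤ ‖w t‖ := by
    intro t i n hN
    by_cases h0 : 0 ≤ n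
    · exact hcomp t i n h0 hN
    · rw [hcut i n t (not_le.mp h0), abs_zero]; exact norm_nonneg _
  have hp2 : ∀ p : Fin m × Fin (N + 1), (((p.2 : ℕ) : ℤ)) ≤ N := fun p => by
    exact_mod_cast Nat.lt_succ_iff.mp p.2.isLt
  -- reversed time
  set g : ℝ → (Fin m × Fin (N + 1) → ℝ) := fun s => w (t₁ - s) with hg
  set g' : ℝ → (Fin m × Fin (N + 1) → ℝ) := fun s => -(w' (t₁ - s)) with hg'
  have hgd : ∀ s ∈ Set.Icc 0 (t₁ - t₀), HasDerivAt g (g' s) s := by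
    intro s hs
    have h1 : HasDerivAt (fun s : ℝ => t₁ - s) (-1) s := by
      simpa using (hasDerivAt_id s).const_sub t₁
    have hmem : t₁ - s ∈ Set.Icc t₀ t₁ := ⟨by linarith [hs.2], by linarith [hs.1]⟩
    have h2 := (hwd (t₁ - s) hmem).scomp s h1
    have h3 : g' s = (-1 : ℝ) • w' (t₁ - s) := by rw [hg', neg_one_smul]
    rw [h3]
    exact h2
  have hbound : ∀ s ∈ Set.Ico 0 (t₁ - t₀), ‖g' s‖ ≤ L * ‖g s‖ + 0 := by
    intro s hs
    rw [add_zero, hg', norm_neg]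
    have hmem : t₁ - s ∈ Set.Icc t₀ t₁ := ⟨by linarith [hs.2], by linarith [hs.1]⟩
    refine (pi_norm_le_iff_of_nonneg (mul_nonneg hL0 (norm_nonneg _))).2 fun p => ?_
    rw [Real.norm_eq_abs]
    exact circuitRHS_abs_le hlam coeff hK0 hK X (t₁ - s) (Int.natCast_nonneg _) (hp2 p) hB0
      (norm_nonneg _) (fun i n' hn' => hB i n' hn' _ hmem) (fun i n' hn' => hlow _ i n' hn') p.1
  have hg0 : ‖g 0‖ ≤ δ := by
    refine (pi_norm_le_iff_of_nonneg hδ0).2 fun p => ?_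
    rw [Real.norm_eq_abs]
    simpa [hg, hw] using hδ p.1 _ (Int.natCast_nonneg _) (hp2 p)
  have hG := norm_le_gronwallBound_of_norm_deriv_right_le (f := g) (f' := g') (δ := δ) (K := L)
    (ε := 0) (a := 0) (b := t₁ - t₀)
    (fun s hs => (hgd s hs).continuousAt.continuousWithinAt)
    (fun s hs => (hgd s (Set.Ico_subset_Icc_self hs)).hasDerivWithinAt) hg0 hbound
  intro i n h0 hN t ht
  have hs : t₁ - t ∈ Set.Icc 0 (t₁ - t₀) := ⟨by linarith [ht.2], by linarith [ht.1]⟩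
  have := hG (t₁ - t) hs
  rw [gronwallBound_ε0, sub_zero] at this
  calc |X i n t| ≤ ‖w t‖ := hcomp t i n h0 hN
    _ = ‖g (t₁ - t)‖ := by simp [hg]
    _ ≤ δ * Real.exp (L * (t₁ - t)) := this

/-- The structure constants are finitely many: a common bound. -/
theorem exists_coeff_bound {m : ℕ} (coeff : Fin m → Fin m → Fin m → Option (Fin 3) → ℝ) :
    ∃ K : ℝ, 0 ≤ K ∧ ∀ i₁ i₂ i₃ μ, |coeff i₁ i₂ i₃ μ| ≤ K := by
  obtain ⟨M, hM⟩ := Finite.exists_le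
    (fun q : Fin m × Fin m × Fin m × Option (Fin 3) => |coeff q.1 q.2.1 q.2.2.1 q.2.2.2|)
  exact ⟨max M 0, le_max_right _ _, fun i₁ i₂ i₃ μ => (hM (i₁, i₂, i₃, μ)).trans (le_max_left _ _)⟩

/-- Corollary (exact backward uniqueness into the invariant subspace `{X_{≤ N} = 0}`): if the low
block is empty at time `t₁` it was empty on all of `[t₀, t₁]`. -/
theorem block_eq_zero_backward {lam : ℝ} (hlam : 1 ≤ lam) {m : ℕ}
    (coeff : Fin m → Fin m → Fin m → Option (Fin 3) → ℝ) (X : Fin m → ℤ → ℝ → ℝ) {t₀ t₁ : ℝ}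
    (N : ℕ)
    (hderiv : ∀ (i : Fin m) (n : ℤ), ∀ t ∈ Set.Icc t₀ t₁,
      HasDerivAt (X i n) (circuitRHS lam coeff X i n t) t)
    (hcut : ∀ (i : Fin m) (n : ℤ) (t : ℝ), n < 0 → X i n t = 0)
    {B : ℝ} (hB0 : 0 ≤ B)
    (hB : ∀ (i : Fin m) (n : ℤ), n ≤ N + 1 → ∀ t ∈ Set.Icc t₀ t₁, |X i n t| ≤ B)
    (hzero : ∀ (i : Fin m) (n : ℤ), 0 ≤ n → n ≤ N → X i n t₁ = 0) :
    ∀ (i : Fin m) (n : ℤ), n ≤ N → ∀ t ∈ Set.Icc t₀ t₁, X i n t = 0 := by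
  obtain ⟨K, hK0, hK⟩ := exists_coeff_bound coeff
  intro i n hN t ht
  by_cases h0 : 0 ≤ n
  · have h := block_backward_gronwall hlam coeff hK0 hK X N hderiv hcut hB0 hB le_rfl
      (fun i n h0 hN => by rw [hzero i n h0 hN, abs_zero]) i n h0 hN t ht
    rw [zero_mul] at h
    exact abs_eq_zero.mp (le_antisymm h (abs_nonneg _))
  · exact hcut i n t (not_le.mp h0)

/-! ## §4 Natural variants (statements only; see the module docstring for their status) -/

/-- The `ℓ^q` version, `1 ≤ q < ∞` arbitrary real exponent: expected TRUE by the same argument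
(Step 4 only needs `Σ a^q ≥ #{trail scales}·ρ'^q → ∞`). `q = 3` is `CircuitTrace`. -/
def CircuitTraceLq (q : ℝ) : Prop :=
  ∀ lam : ℝ, 1 < lam → ∀ (m : ℕ) (coeff : Fin m → Fin m → Fin m → Option (Fin 3) → ℝ),
    IsSymm coeff → IsCyclic coeff → ∀ T : ℝ, 0 < T → ∀ X : Fin m → ℤ → ℝ → ℝ,
    (∀ (i : Fin m) (n : ℤ), ContinuousOn (X i n) (Set.Ico 0 T)) →
    (∀ (i : Fin m) (n : ℤ), ∀ t ∈ Set.Ioo 0 T, HasDerivAt (X i n) (circuitRHS lam coeff X i n t) t) →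
    (∀ (i : Fin m) (n : ℤ) (t : ℝ), n < 0 → X i n t = 0) →
    (∀ T' ∈ Set.Ioo 0 T, ∃ C : ℝ, ∀ (i : Fin m) (n : ℤ), ∀ t ∈ Set.Icc 0 T',
        lam ^ ((4 : ℝ) * n) * |X i n t| ≤ C) →
    (∃ M : ℝ, ∀ t ∈ Set.Ico 0 T, ∀ s : Finset ℤ,
        ∑ n ∈ s, ∑ i : Fin m, (lam ^ ((1 / 5 : ℝ) * n) * |X i n t|) ^ q ≤ M) →
    ∃ C : ℝ, ∀ (i : Fin m) (n : ℤ), ∀ t ∈ Set.Ico 0 T, lam ^ ((4 : ℝ) * n) * |X i n t| ≤ C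

theorem circuitTraceLq_three : CircuitTraceLq 3 ↔ CircuitTrace := by
  simp only [CircuitTraceLq, circuitTrace_iff, CircuitTrace']
  norm_cast

/-- The `ℓ^∞` (Type-I, `L^∞`-rate) tier: `sup_{n,t} lam^{n/5}|X_{i,n}(t)| ≤ M` instead of the `ℓ³`
bound. Conjecturally FALSE (a truncated Type-I DSS pump, crux `CircuitPump`, would refute it); the
architecture above proves only the frozen-trail statement under this hypothesis. Recorded so that
nobody mistakes the `ℓ³` theorem for Type-I exclusion. -/
def CircuitTraceLinfty : Prop :=
  ∀ lam : ℝ, 1 < lam → ∀ (m : ℕ) (coeff : Fin m → Fin m → Fin m → Option (Fin 3) → ℝ),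
    IsSymm coeff → IsCyclic coeff → ∀ T : ℝ, 0 < T → ∀ X : Fin m → ℤ → ℝ → ℝ,
    (∀ (i : Fin m) (n : ℤ), ContinuousOn (X i n) (Set.Ico 0 T)) →
    (∀ (i : Fin m) (n : ℤ), ∀ t ∈ Set.Ioo 0 T, HasDerivAt (X i n) (circuitRHS lam coeff X i n t) t) →
    (∀ (i : Fin m) (n : ℤ) (t : ℝ), n < 0 → X i n t = 0) →
    (∀ T' ∈ Set.Ioo 0 T, ∃ C : ℝ, ∀ (i : Fin m) (n : ℤ), ∀ t ∈ Set.Icc 0 T',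
        lam ^ ((4 : ℝ) * n) * |X i n t| ≤ C) →
    (∃ M : ℝ, ∀ t ∈ Set.Ico 0 T, ∀ (i : Fin m) (n : ℤ), lam ^ ((1 / 5 : ℝ) * n) * |X i n t| ≤ M) →
    ∃ C : ℝ, ∀ (i : Fin m) (n : ℤ), ∀ t ∈ Set.Ico 0 T, lam ^ ((4 : ℝ) * n) * |X i n t| ≤ C

/-- `CircuitTrace` with the cyclic cancellation (4.3) DELETED (symmetry kept). STATUS: unknown,
plausibly FALSE — cancellation enters the architecture only through energy monotonicity/flux
(funding); without it a pulse converging, scale after scale, to the threshold (stable manifold) of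
a NON-conservative lingering state (e.g. the unstable equilibrium `a = 1/c_R` of a same-scale
Riccati term `c_R lam^n X_n²`) could have sojourns `S_n → ∞` (finite blow-up time since
`Σ S_n lam^{-4n/5} < ∞`) and a trail decaying during the long sojourns, hence bounded `ℓ³`. No
closed-form witness: feed-forward chains `Ẋ_n = -lam^{4n/5}X_n + c lam^{n-1}X_{n-1}²` equilibrate to
`a_n ≈ (c'a_0)^{2^n}` (plateau, `ℓ³ → ∞` at the blow-up time) and top-down parametric chains
`Ẋ_n = -lam^{4n/5}X_n + κ lam^n X_n X_{n+1}` decay. -/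
def CircuitTraceWithoutCyclic : Prop :=
  ∀ lam : ℝ, 1 < lam → ∀ (m : ℕ) (coeff : Fin m → Fin m → Fin m → Option (Fin 3) → ℝ),
    IsSymm coeff → ∀ T : ℝ, 0 < T → ∀ X : Fin m → ℤ → ℝ → ℝ,
    (∀ (i : Fin m) (n : ℤ), ContinuousOn (X i n) (Set.Ico 0 T)) →
    (∀ (i : Fin m) (n : ℤ), ∀ t ∈ Set.Ioo 0 T, HasDerivAt (X i n) (circuitRHS lam coeff X i n t) t) →
    (∀ (i : Fin m) (n : ℤ) (t : ℝ), n < 0 → X i n t = 0) →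
    (∀ T' ∈ Set.Ioo 0 T, ∃ C : ℝ, ∀ (i : Fin m) (n : ℤ), ∀ t ∈ Set.Icc 0 T',
        lam ^ ((4 : ℝ) * n) * |X i n t| ≤ C) →
    (∃ M : ℝ, ∀ t ∈ Set.Ico 0 T, ∀ s : Finset ℤ,
        ∑ n ∈ s, ∑ i : Fin m, (lam ^ ((1 / 5 : ℝ) * n) * |X i n t|) ^ 3 ≤ M) →
    ∃ C : ℝ, ∀ (i : Fin m) (n : ℤ), ∀ t ∈ Set.Ico 0 T, lam ^ ((4 : ℝ) * n) * |X i n t| ≤ C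

/-- `CircuitTrace` with the cutoff `X_{n<0} = 0` DELETED (two-sided chains, possibly infinite energy
at `n → -∞`). STATUS: unknown, plausibly TRUE — funding is scale-local (`E_{≥b} < ∞` for every
`b`, flux into `{≥ b}` is `≤ m³K M lam^{2b/5}`), the maximum principles and the enabler chain are
local, and the low-block Grönwall works on infinite blocks with geometric weights; only "initial
inactivity of high scales" (from the a-priori bound) is used globally. So the cutoff is possibly
unnecessary; it is what makes the low block finite in `block_backward_gronwall`. -/
def CircuitTraceWithoutCutoff : Prop :=
  ∀ lam : ℝ, 1 < lam → ∀ (m : ℕ) (coeff : Fin m → Fin m → Fin m → Option (Fin 3) → ℝ),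
    IsSymm coeff → IsCyclic coeff → ∀ T : ℝ, 0 < T → ∀ X : Fin m → ℤ → ℝ → ℝ,
    (∀ (i : Fin m) (n : ℤ), ContinuousOn (X i n) (Set.Ico 0 T)) →
    (∀ (i : Fin m) (n : ℤ), ∀ t ∈ Set.Ioo 0 T, HasDerivAt (X i n) (circuitRHS lam coeff X i n t) t) →
    (∀ T' ∈ Set.Ioo 0 T, ∃ C : ℝ, ∀ (i : Fin m) (n : ℤ), ∀ t ∈ Set.Icc 0 T',
        lam ^ ((4 : ℝ) * n) * |X i n t| ≤ C) →
    (∃ M : ℝ, ∀ t ∈ Set.Ico 0 T, ∀ s : Finset ℤ,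
        ∑ n ∈ s, ∑ i : Fin m, (lam ^ ((1 / 5 : ℝ) * n) * |X i n t|) ^ 3 ≤ M) →
    ∃ C : ℝ, ∀ (i : Fin m) (n : ℤ), ∀ t ∈ Set.Ico 0 T, lam ^ ((4 : ℝ) * n) * |X i n t| ≤ C

/-- The crux is the cutoff-free variant restricted to one-sided data (formally weaker). -/
theorem circuitTrace_of_withoutCutoff (h : CircuitTraceWithoutCutoff) : CircuitTrace := by
  rw [circuitTrace_iff]
  intro lam hlam m coeff hsym hcyc T hT X hcont hderiv _hcut hapr hM
  exact h lam hlam m coeff hsym hcyc T hT X hcont hderiv hapr hM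

/-- The crux is the cyclic-free variant restricted to cyclic circuits (formally weaker). -/
theorem circuitTrace_of_withoutCyclic (h : CircuitTraceWithoutCyclic) : CircuitTrace := by
  rw [circuitTrace_iff]
  intro lam hlam m coeff hsym _hcyc T hT X hcont hderiv hcut hapr hM
  exact h lam hlam m coeff hsym T hT X hcont hderiv hcut hapr hM

/-- The Type-I tier is (formally) the stronger statement: an `ℓ³` bound gives an `ℓ^∞` bound. -/
theorem circuitTrace_of_linfty (h : CircuitTraceLinfty) : CircuitTrace := by
  rw [circuitTrace_iff]
  intro lam hlam m coeff hsym hcyc T hT X hcont hderiv hcut hapr hM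
  obtain ⟨M, hM⟩ := hM
  refine h lam hlam m coeff hsym hcyc T hT X hcont hderiv hcut hapr ⟨max M 1, fun t ht i n => ?_⟩
  have h1 := hM t ht {n}
  rw [Finset.sum_singleton] at h1
  have h2 : (lam ^ ((1 / 5 : ℝ) * n) * |X i n t|) ^ 3 ≤ M :=
    le_trans (Finset.single_le_sum (f := fun i => (lam ^ ((1 / 5 : ℝ) * n) * |X i n t|) ^ 3)
      (fun j _ => by positivity) (Finset.mem_univ i)) h1
  have h0 : 0 ≤ lam ^ ((1 / 5 : ℝ) * n) * |X i n t| := by positivity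
  by_contra hlt
  have hlt' := not_le.mp hlt
  set x := lam ^ ((1 / 5 : ℝ) * n) * |X i n t| with hx
  have h3 : 1 ≤ x := (lt_of_le_of_lt (le_max_right _ _) hlt').le
  have h4 : M < x := lt_of_le_of_lt (le_max_left _ _) hlt'
  have h5 : x ≤ x ^ 3 :=
    calc x = x * 1 * 1 := by ring
      _ ≤ x * x * x := by gcongr
      _ = x ^ 3 := by ring
  linarith

/-! ## §5 Bridge to Tao's encoding; the `ℓ³` hypothesis is load-bearing (Thm 4.2) -/

/-! ### The two encodings of the offset set -/

/-- The offset vector `(μ₁, μ₂, μ₃) ∈ S ⊂ ℤ³` of an `Option (Fin 3)` label: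
`none ↦ (0,0,0)`, `some a ↦ e_a`. -/
def shiftOf (μ : Option (Fin 3)) : ℤ × ℤ × ℤ :=
  Option.elim μ (0, 0, 0) ![(1, 0, 0), (0, 1, 0), (0, 0, 1)]

@[simp] theorem shiftOf_none : shiftOf none = (0, 0, 0) := rfl
@[simp] theorem shiftOf_zero : shiftOf (some 0) = (1, 0, 0) := rfl
@[simp] theorem shiftOf_one : shiftOf (some 1) = (0, 1, 0) := rfl
@[simp] theorem shiftOf_two : shiftOf (some 2) = (0, 0, 1) := rfl

/-- Tao's `ℤ³`-indexed structure constants read in the `Option (Fin 3)` encoding of the route. -/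
def coeffOf {m : ℕ} (α : Fin m → Fin m → Fin m → ℤ × ℤ × ℤ → ℝ) :
    Fin m → Fin m → Fin m → Option (Fin 3) → ℝ :=
  fun i₁ i₂ i₃ μ => α i₁ i₂ i₃ (shiftOf μ)

/-- Summing over the four labels is summing over the shift set `S`. -/
theorem sum_option_eq_sum_shiftSet {M : Type*} [AddCommMonoid M] (f : ℤ × ℤ × ℤ → M) :
    ∑ μ : Option (Fin 3), f (shiftOf μ) = ∑ μ ∈ shiftSet, f μ := by
  rw [sum_shiftSet, Fintype.sum_option, Fin.sum_univ_three]
  simp only [shiftOf_none, shiftOf_zero, shiftOf_one, shiftOf_two]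
  abel

/-- Tao's quadratic term (4.8)/(4.13) written with the `Option (Fin 3)` labels. -/
theorem quadTerm_eq_sum_option (ε₀ : ℝ) {m : ℕ} (α : Fin m → Fin m → Fin m → ℤ × ℤ × ℤ → ℝ)
    (X : Fin m → ℤ → ℝ → ℝ) (i : Fin m) (n : ℤ) (t : ℝ) :
    quadTerm ε₀ α X i n t = ∑ i₁ : Fin m, ∑ i₂ : Fin m, ∑ μ : Option (Fin 3),
      α i₁ i₂ i (shiftOf μ) * (1 + ε₀) ^ ((5 : ℝ) * (n - (shiftOf μ).2.2) / 2) *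
        (X i₁ (n - (shiftOf μ).2.2 + (shiftOf μ).1) t *
          X i₂ (n - (shiftOf μ).2.2 + (shiftOf μ).2.1) t) := by
  unfold quadTerm
  refine Finset.sum_congr rfl fun i₁ _ => Finset.sum_congr rfl fun i₂ _ => ?_
  exact (sum_option_eq_sum_shiftSet (fun μ => α i₁ i₂ i μ *
    (1 + ε₀) ^ ((5 : ℝ) * (n - μ.2.2) / 2) * (X i₁ (n - μ.2.2 + μ.1) t * X i₂ (n - μ.2.2 + μ.2.1) t))).symm

/-- **The route's circuit class at `lam = (1+ε₀)^{5/2}` IS Tao's viscous model (4.13)**: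
`F_{i,n} = -(1+ε₀)^{2n} X_{i,n} + [quadratic term of (4.8)]` for the re-encoded constants. -/
theorem circuitRHS_coeffOf {ε₀ : ℝ} (hε₀ : -1 < ε₀) {m : ℕ}
    (α : Fin m → Fin m → Fin m → ℤ × ℤ × ℤ → ℝ) (X : Fin m → ℤ → ℝ → ℝ) (i : Fin m) (n : ℤ)
    (t : ℝ) :
    circuitRHS ((1 + ε₀) ^ ((5 : ℝ) / 2)) (coeffOf α) X i n t =
      -((1 + ε₀) ^ ((2 : ℝ) * n)) * X i n t + quadTerm ε₀ α X i n t := by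
  have h0 : 0 ≤ 1 + ε₀ := by linarith
  rw [quadTerm_eq_sum_option]
  unfold circuitRHS coeffOf
  congr 1
  · rw [← Real.rpow_mul h0]
    congr 2
    ring
  · refine Finset.sum_congr rfl fun i₁ _ => Finset.sum_congr rfl fun i₂ _ =>
      Finset.sum_congr rfl fun μ _ => ?_
    rw [← Real.rpow_mul h0]
    rcases μ with _ | a
    · simp only [reduceCtorEq, ite_false, sub_zero, add_zero, shiftOf_none, Int.cast_zero]
      ring_nf
    · fin_cases a
      · simp only [Fin.zero_eta, Fin.isValue, Option.some.injEq, Fin.reduceEq, ite_false,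
          sub_zero, ite_true, shiftOf_zero, Int.cast_zero, add_zero]
        ring_nf
      · simp only [Fin.mk_one, Fin.isValue, Option.some.injEq, Fin.reduceEq, ite_false,
          sub_zero, ite_true, add_zero, shiftOf_one, Int.cast_zero]
        ring_nf
      · simp only [Fin.reduceFinMk, Fin.isValue, ite_true, Option.some.injEq, Fin.reduceEq,
          ite_false, zero_sub, shiftOf_two, Int.cast_one, add_zero]
        ring_nf

/-- Symmetry (4.2) transfers to the `Option (Fin 3)` encoding. -/
theorem isSymm_coeffOf {m : ℕ} {α : Fin m → Fin m → Fin m → ℤ × ℤ × ℤ → ℝ}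
    (h : IsSymmetricCoeff α) : IsSymm (coeffOf α) := by
  intro i₁ i₂ i₃ μ
  rcases μ with _ | a
  · exact h i₁ i₂ i₃ 0 0 0 (by decide)
  · fin_cases a
    · exact h i₁ i₂ i₃ 1 0 0 (by decide)
    · exact h i₁ i₂ i₃ 0 1 0 (by decide)
    · exact h i₁ i₂ i₃ 0 0 1 (by decide)

/-- The six permutations of `Fin 3`, for expanding `∑ σ : Perm (Fin 3)`. -/
theorem univ_perm_fin_three : (Finset.univ : Finset (Equiv.Perm (Fin 3))) =
    {1, Equiv.swap 0 1, Equiv.swap 0 2, Equiv.swap 1 2, Equiv.swap 0 1 * Equiv.swap 0 2,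
      Equiv.swap 0 2 * Equiv.swap 0 1} := by
  symm
  apply Finset.eq_univ_of_card
  rw [Fintype.card_perm, Fintype.card_fin]
  decide

/-- `∑ σ : Perm (Fin 3)` written out. -/
theorem sum_perm_fin_three {M : Type*} [AddCommMonoid M] (f : Equiv.Perm (Fin 3) → M) :
    ∑ σ : Equiv.Perm (Fin 3), f σ =
      f 1 + f (Equiv.swap 0 1) + f (Equiv.swap 0 2) + f (Equiv.swap 1 2) +
        f (Equiv.swap 0 1 * Equiv.swap 0 2) + f (Equiv.swap 0 2 * Equiv.swap 0 1) := by
  rw [univ_perm_fin_three, Finset.sum_insert (by decide), Finset.sum_insert (by decide),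
    Finset.sum_insert (by decide), Finset.sum_insert (by decide), Finset.sum_insert (by decide),
    Finset.sum_singleton]
  abel

/-- Cancellation (4.3) transfers to the `Option (Fin 3)` encoding. -/
theorem isCyclic_coeffOf {m : ℕ} {α : Fin m → Fin m → Fin m → ℤ × ℤ × ℤ → ℝ}
    (h : IsCancellingCoeff α) : IsCyclic (coeffOf α) := by
  intro v μ
  rw [sum_perm_fin_three]
  simp only [coeffOf]
  rcases μ with _ | a
  · have := h (v 0) (v 1) (v 2) 0 0 0 (by decide)
    simp only [Option.map_none, shiftOf_none, Equiv.Perm.one_apply, Equiv.swap_apply_left,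
      Equiv.swap_apply_right, Equiv.Perm.mul_apply, Fin.isValue] at this ⊢
    simp only [Equiv.swap_apply_def, Fin.isValue, Fin.reduceEq, ite_false, ite_true] at this ⊢
    linarith
  · have h1s : (1 : Equiv.Perm (Fin 3)).symm = 1 := rfl
    fin_cases a
    · have := h (v 0) (v 1) (v 2) 1 0 0 (by decide)
      simp [Equiv.swap_apply_def, Equiv.Perm.mul_def, Equiv.symm_swap, h1s] at this ⊢
      linarith
    · have := h (v 0) (v 1) (v 2) 0 1 0 (by decide)
      simp [Equiv.swap_apply_def, Equiv.Perm.mul_def, Equiv.symm_swap, h1s] at this ⊢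
      linarith
    · have := h (v 0) (v 1) (v 2) 0 0 1 (by decide)
      simp [Equiv.swap_apply_def, Equiv.Perm.mul_def, Equiv.symm_swap, h1s] at this ⊢
      linarith

/-! ### The `ℓ³` hypothesis is load-bearing: without it, Tao's Theorem 4.2 circuit blows up -/

/-- `CircuitTrace` with the `ℓ³`-critical hypothesis DELETED: an unconditional
`H¹⁰`-continuation claim for every admissible circuit. -/
def CircuitTraceWithoutL3 : Prop :=
  ∀ lam : ℝ, 1 < lam → ∀ (m : ℕ) (coeff : Fin m → Fin m → Fin m → Option (Fin 3) → ℝ),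
    IsSymm coeff → IsCyclic coeff → ∀ T : ℝ, 0 < T → ∀ X : Fin m → ℤ → ℝ → ℝ,
    (∀ (i : Fin m) (n : ℤ), ContinuousOn (X i n) (Set.Ico 0 T)) →
    (∀ (i : Fin m) (n : ℤ), ∀ t ∈ Set.Ioo 0 T, HasDerivAt (X i n) (circuitRHS lam coeff X i n t) t) →
    (∀ (i : Fin m) (n : ℤ) (t : ℝ), n < 0 → X i n t = 0) →
    (∀ T' ∈ Set.Ioo 0 T, ∃ C : ℝ, ∀ (i : Fin m) (n : ℤ), ∀ t ∈ Set.Icc 0 T',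
        lam ^ ((4 : ℝ) * n) * |X i n t| ≤ C) →
    ∃ C : ℝ, ∀ (i : Fin m) (n : ℤ), ∀ t ∈ Set.Ico 0 T, lam ^ ((4 : ℝ) * n) * |X i n t| ≤ C

/-- The well-posedness input (standard, NOT in tree; filed for construction): **maximal `H¹⁰`
solutions with the blow-up alternative** for the circuit class, from one excited mode. For every
`lam > 1`, every admissible circuit and the datum `X_{i,n}(0) = 1_{(i,n)=(i₀,n₀)}` (`n₀ ≥ 0`),
EITHER there is a global solution — `C¹` on `[0,∞)` (one-sided at `t = 0`), vanishing below
scale `n₀`, a-priori bounded in `sup_n lam^{4n}|X_{i,n}|` on every `[0,T]` — OR there is a solution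
on some `[0,T*)`, `0 < T* < ∞`, with the same properties on compact sub-intervals, whose weighted
amplitude `lam^{4n}|X_{i,n}(t)|` is unbounded on `[0,T*)`. (Proof sketch, for whoever constructs
it: with the cutoff the nonlinearity is locally Lipschitz on the Banach space
`{sup_n lam^{4n}|x_n| < ∞}` — `lam^{4n}|N_n(x)| ≤ 4m²K lam^{8-3n}‖x‖²` for `n ≥ 0` — and the
dissipation is diagonal, so the Duhamel formulation `x(t) = e^{tA}x₀ + ∫₀ᵗ e^{(t-s)A}N(x(s))ds`,
`A = -diag(lam^{4n/5})`, is a contraction on short time intervals; components are then classical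
solutions of scalar linear ODEs with continuous forcing; continuation is the usual argument.)
It is used here ONLY as the hypothesis of `circuitTraceWithoutL3_false` (negative lemma modulo `H`);
nothing in this file asserts it. -/
def MaximalH10Solutions : Prop :=
  ∀ lam : ℝ, 1 < lam → ∀ (m : ℕ) (coeff : Fin m → Fin m → Fin m → Option (Fin 3) → ℝ),
    IsSymm coeff → IsCyclic coeff → ∀ (i₀ : Fin m) (n₀ : ℤ), 0 ≤ n₀ →
    (∃ X : Fin m → ℤ → ℝ → ℝ,
      (∀ (i : Fin m) (n : ℤ), ContDiffOn ℝ 1 (X i n) (Set.Ici 0)) ∧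
      (∀ (i : Fin m) (n : ℤ) (t : ℝ), 0 ≤ t →
        HasDerivWithinAt (X i n) (circuitRHS lam coeff X i n t) (Set.Ici 0) t) ∧
      (∀ (i : Fin m) (n : ℤ), X i n 0 = if i = i₀ ∧ n = n₀ then 1 else 0) ∧
      (∀ (i : Fin m) (n : ℤ) (t : ℝ), n < n₀ → X i n t = 0) ∧
      (∀ T : ℝ, 0 < T → ∃ C : ℝ, ∀ (i : Fin m) (n : ℤ), ∀ t ∈ Set.Icc 0 T,
        lam ^ ((4 : ℝ) * n) * |X i n t| ≤ C)) ∨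
    (∃ T : ℝ, 0 < T ∧ ∃ X : Fin m → ℤ → ℝ → ℝ,
      (∀ (i : Fin m) (n : ℤ), ContinuousOn (X i n) (Set.Ico 0 T)) ∧
      (∀ (i : Fin m) (n : ℤ), ∀ t ∈ Set.Ioo 0 T,
        HasDerivAt (X i n) (circuitRHS lam coeff X i n t) t) ∧
      (∀ (i : Fin m) (n : ℤ), X i n 0 = if i = i₀ ∧ n = n₀ then 1 else 0) ∧
      (∀ (i : Fin m) (n : ℤ) (t : ℝ), n < n₀ → X i n t = 0) ∧
      (∀ T' ∈ Set.Ioo 0 T, ∃ C : ℝ, ∀ (i : Fin m) (n : ℤ), ∀ t ∈ Set.Icc 0 T',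
        lam ^ ((4 : ℝ) * n) * |X i n t| ≤ C) ∧
      (∀ C : ℝ, ∃ (i : Fin m) (n : ℤ), ∃ t ∈ Set.Ico 0 T, C < lam ^ ((4 : ℝ) * n) * |X i n t|))

/-- `√(x²/2) = |x|/√2`. -/
theorem sqrt_half_sq (x : ℝ) : Real.sqrt (1 / 2 * x ^ 2) = |x| / Real.sqrt 2 := by
  rw [show (1 / 2 : ℝ) * x ^ 2 = x ^ 2 / 2 by ring, Real.sqrt_div (sq_nonneg x),
    Real.sqrt_sq_eq_abs]

/-- **The `ℓ³` hypothesis of `CircuitTrace` is load-bearing.** Granted maximal `H¹⁰` solutions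
with the blow-up alternative (`MaximalH10Solutions`, standard), the `ℓ³`-free variant is FALSE:
Tao's Theorem 4.2 circuit (tree: `TaoCascade.odeBlowup_holds`, at `ε₀ = 1/2`,
`lam = (3/2)^{5/2}`, re-encoded by `coeffOf`) has no global regular solution from one excited
mode, so its maximal solution blows up in `H¹⁰` at a finite time, where the variant would bound
it. (An exact solution of the viscous circuit is a `CascadeODESolution` with `E = X²/2`,
`K₁ = √2` — the dissipation is Tao's `O((1+ε₀)^{2n}E^{1/2})` term — and `K₂ = 0`.) -/
theorem circuitTraceWithoutL3_false (H : MaximalH10Solutions) : ¬ CircuitTraceWithoutL3 := by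
  intro hCT
  obtain ⟨m, i₀, α, hαs, hαc, hN⟩ := odeBlowup_holds (1 / 2) (by norm_num) (by norm_num)
  obtain ⟨N₀, hN₀⟩ := hN (Real.sqrt 2) 0 (Real.sqrt_nonneg _) le_rfl
  set n₀ : ℤ := max N₀ 0 with hn₀
  set lam : ℝ := (1 + 1 / 2 : ℝ) ^ ((5 : ℝ) / 2) with hlam
  have h32 : (0 : ℝ) ≤ 1 + 1 / 2 := by norm_num
  have hlam1 : 1 < lam := Real.one_lt_rpow (by norm_num) (by norm_num)
  have hε : (-1 : ℝ) < 1 / 2 := by norm_num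
  -- `lam^{4n} = (3/2)^{10n}` and `lam^{4n/5} = (3/2)^{2n}`
  have hpow10 : ∀ n : ℤ, lam ^ ((4 : ℝ) * n) = (1 + 1 / 2 : ℝ) ^ ((10 : ℝ) * n) := by
    intro n; rw [hlam, ← Real.rpow_mul h32]; congr 1; ring
  rcases H lam hlam1 m (coeffOf α) (isSymm_coeffOf hαs) (isCyclic_coeffOf hαc) i₀ n₀
      (le_max_right _ _) with
    ⟨X, hC1, hderiv, hinit, hlow, hapr⟩ | ⟨T, hT, X, hcont, hderiv, hinit, hlow, hapr, hunb⟩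
  · -- global branch: an exact global regular solution contradicts Thm. 4.2
    refine hN₀ n₀ (le_max_left _ _) ⟨X, fun i n t => 1 / 2 * X i n t ^ 2, ?_⟩
    have hFn : ∀ (i : Fin m) (n : ℤ) (t : ℝ), 0 ≤ t →
        derivWithin (X i n) (Set.Ici 0) t =
          -((1 + 1 / 2 : ℝ) ^ ((2 : ℝ) * n)) * X i n t + quadTerm (1 / 2) α X i n t := by
      intro i n t ht
      rw [(hderiv i n t ht).derivWithin (uniqueDiffOn_Ici 0 t ht), hlam, circuitRHS_coeffOf hε]
    have hEn : ∀ (i : Fin m) (n : ℤ) (t : ℝ), 0 ≤ t →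
        derivWithin (fun t => 1 / 2 * X i n t ^ 2) (Set.Ici 0) t =
          X i n t * (-((1 + 1 / 2 : ℝ) ^ ((2 : ℝ) * n)) * X i n t + quadTerm (1 / 2) α X i n t) := by
      intro i n t ht
      have h1 := ((hderiv i n t ht).mul (hderiv i n t ht)).const_mul (1 / 2 : ℝ)
      have h2 : derivWithin (fun t => 1 / 2 * X i n t ^ 2) (Set.Ici 0) t =
          1 / 2 * (circuitRHS lam (coeffOf α) X i n t * X i n t +
            X i n t * circuitRHS lam (coeffOf α) X i n t) := by
        rw [← h1.derivWithin (uniqueDiffOn_Ici 0 t ht)]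
        congr 1; funext s; simp only [Pi.mul_apply]; ring
      rw [h2, hlam, circuitRHS_coeffOf hε]; ring
    exact
      { contDiffOn_X := hC1
        contDiffOn_E := fun i n => contDiffOn_const.mul ((hC1 i n).pow 2)
        nonneg_E := fun i n t _ => by positivity
        apriori_X := by
          intro T' hT'
          obtain ⟨C, hC⟩ := hapr T' hT'
          refine ⟨2 * max C 0, fun t ht i n => ?_⟩
          have hb := hC i n t ht
          rw [hpow10] at hb
          by_cases hn : n < n₀
          · rw [hlow i n t hn, abs_zero, mul_zero]; positivity
          · have hn0 : (0 : ℝ) ≤ n := by exact_mod_cast le_trans (le_max_right _ _) (not_lt.mp hn)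
            have h1 : (1 : ℝ) ≤ (1 + 1 / 2 : ℝ) ^ ((10 : ℝ) * n) :=
              Real.one_le_rpow (by norm_num) (by positivity)
            have h2 : |X i n t| ≤ max C 0 :=
              le_trans (le_trans (le_mul_of_one_le_left (abs_nonneg _) h1) hb) (le_max_left _ _)
            have h3 : (1 + 1 / 2 : ℝ) ^ ((10 : ℝ) * n) * |X i n t| ≤ max C 0 :=
              hb.trans (le_max_left _ _)
            nlinarith
        apriori_E := by
          intro T' hT'
          obtain ⟨C, hC⟩ := hapr T' hT'
          refine ⟨2 * max C 0, fun t ht i n => ?_⟩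
          have hb := hC i n t ht
          rw [hpow10] at hb
          have hsq : Real.sqrt (1 / 2 * X i n t ^ 2) ≤ |X i n t| := by
            rw [sqrt_half_sq]
            exact div_le_self (abs_nonneg _) (by
              rw [show (1:ℝ) = Real.sqrt 1 from Real.sqrt_one.symm]
              exact Real.sqrt_le_sqrt (by norm_num))
          have hpos : 0 ≤ 1 + (1 + 1 / 2 : ℝ) ^ ((10 : ℝ) * n) := by positivity
          by_cases hn : n < n₀
          · rw [hlow i n t hn]; simp
          · have h1 : (1 : ℝ) ≤ (1 + 1 / 2 : ℝ) ^ ((10 : ℝ) * n) := by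
              have hn0 : (0 : ℝ) ≤ n := by
                exact_mod_cast le_trans (le_max_right _ _) (not_lt.mp hn)
              exact Real.one_le_rpow (by norm_num) (by positivity)
            have h2 : |X i n t| ≤ max C 0 :=
              le_trans (le_trans (le_mul_of_one_le_left (abs_nonneg _) h1) hb) (le_max_left _ _)
            have h3 : (1 + 1 / 2 : ℝ) ^ ((10 : ℝ) * n) * |X i n t| ≤ max C 0 :=
              hb.trans (le_max_left _ _)
            calc (1 + (1 + 1 / 2 : ℝ) ^ ((10 : ℝ) * n)) * Real.sqrt (1 / 2 * X i n t ^ 2)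
                ≤ (1 + (1 + 1 / 2 : ℝ) ^ ((10 : ℝ) * n)) * |X i n t| :=
                  mul_le_mul_of_nonneg_left hsq hpos
              _ ≤ 2 * max C 0 := by nlinarith
        init_E := fun i n => rfl
        init_X := hinit
        motion := by
          intro i n t ht
          rw [hFn i n t ht, sqrt_half_sq]
          have hs : (0 : ℝ) < Real.sqrt 2 := Real.sqrt_pos.2 (by norm_num)
          rw [show -((1 + 1 / 2 : ℝ) ^ ((2 : ℝ) * n)) * X i n t + quadTerm (1 / 2) α X i n t -
              quadTerm (1 / 2) α X i n t = -((1 + 1 / 2 : ℝ) ^ ((2 : ℝ) * n) * X i n t) by ring,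
            abs_neg, abs_mul, abs_of_nonneg (Real.rpow_nonneg h32 _)]
          rw [show Real.sqrt 2 * (1 + 1 / 2 : ℝ) ^ ((2 : ℝ) * n) * (|X i n t| / Real.sqrt 2) =
              (1 + 1 / 2 : ℝ) ^ ((2 : ℝ) * n) * |X i n t| by field_simp]
        energy := by
          intro i n t ht
          rw [hEn i n t ht]
          have : 0 ≤ (1 + 1 / 2 : ℝ) ^ ((2 : ℝ) * n) * (X i n t * X i n t) :=
            mul_nonneg (Real.rpow_nonneg h32 _) (mul_self_nonneg _)
          nlinarith
        defect_lower := fun i n t _ => le_rfl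
        defect_upper := fun i n t _ => by simp
        noLow_X := fun i n t hn _ => hlow i n t hn
        noLow_E := fun i n t hn _ => by simp [hlow i n t hn] }
  · -- blow-up branch: the variant would bound the maximal solution up to its blow-up time
    obtain ⟨C, hC⟩ := hCT lam hlam1 m (coeffOf α) (isSymm_coeffOf hαs) (isCyclic_coeffOf hαc)
      T hT X hcont hderiv (fun i n t hn => hlow i n t (lt_of_lt_of_le hn (le_max_right _ _)))
      hapr
    obtain ⟨i, n, t, ht, hlt⟩ := hunb C
    exact absurd (hC i n t ht) (not_le.mpr hlt)


/-! ## §6 Ideator first lemmas (Cruxes/CircuitTrace/SketchIdeator2.lean, SketchIdeator3.lean) — the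
disprover's cheap attacks (2026-08-16; prose, no formal kill)

* `Ideator2.PersistenceOrBlame` — TRUE (sketch): `d a_j/dτ ≥ -(1 + 3m²A·Mc) a_j - m²A lam^{-3/5} ρ²`
  in local time (every term but the `(0,0,1)` source carries a factor at scale `j`; one factor of
  each is bounded by `Mc` or `ρ`), integrate the linear inequality; `K = 3m²` depends on `m` only.
* `Ideator2.TypeIClock` — TRUE (sketch), although it is FORWARD Type-I timing: quiet-above-`k`
  episodes are finitely many because every re-ignition of scale `k` must come from `k-1` and the
  rise of `a_k` from `δ/2` to `δ` costs `≥ τ_min lam^{-4k/5}` of TIME (bounded rates), while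
  `T < ∞`; after the last one some scale `≥ k` is always `δ`-active and funding (F2) gives
  `T - t_k ≤ C lam^{-4k/5}`. Needs `δ ≤ δ₀` of (F3) and the energy identity (IsCyc + a-priori bound).
* `Ideator2.HalfLatticeBackwardUniqueness` — TRUE: the infinite-block version of
  `block_eq_zero_backward` (bounded `φ = sup_{n≤N} a_n`, `φ(s) ≤ L∫_s^{s₁}φ`, iterate). Note it needs
  the amplitude bound at scale `N+1` too (its hypothesis quantifies all `n` ✓).
* `Ideator2.BandObservability` — TRUE (sketch): lower Grönwall for `ψ = max_{band} a_n` with leak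
  `m²A lam^{(4nb-3)/5}ρ²`; `K = 4m²`.
* `Ideator3.TraceInequality` — TRUE (sketch): for `H_j = Σ_{n≤j} lam^{θ(n-j)}|a_n|³`,
  `dH_j/dt ≥ -L lam^{4j/5} H_j` by one-sided coupling + Young (`|a_n|²a_{n-1}² ≤ Mc(⅔|a_n|³+⅓a_{n-1}³)`,
  discount mismatch costs `lam^θ`); this IS the weighted critical-unit Grönwall of §3 read forward,
  in `ℓ³` form — the right kernel for the crux.
* `Ideator3.LateActivitySparse` — TRUE given TraceInequality: deposits `e^{-LK}δ³` per late-active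
  scale, `Σ_j H_j ≤ M/(1-lam^{-θ})` (= the frozen-trail counting of the architecture, Step 3–4).
* `Ideator3.TriadFlux` — TRUE: exactly the flux of `trilinear_cancel` (only `μ = some 2` at base `n`
  lands in the block above `n`); termwise differentiation of the `tsum` by the a-priori bound.
* `Ideator3.ValveBudget` — SUSPECT AS STATED (constant shape), harmless for the line: the influx
  through a `δ`-quiet valve is `≤ 2m³A lam^{(2n-1)/5} δ² a_{n+1} ≤ 2m³A M^{1/3} lam^{-3/5}·δ² lam^{2n/5}`,
  the SAME order `δ²` as the minimal dissipation `δ² lam^{2(n+1)/5}` of a `δ`-active scale above; the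
  ratio `r = 2m³A M^{1/3} lam^{-3/5}` does not improve as `δ → 0`, so "dissipation beats the cubic
  leakage once `δ ≤ δ₀(lam,m,coeff)`" holds only when `r < 1`, and then with `C = C(lam,m,coeff,M)`.
  For `r ≥ 1` energetics allow a pipeline (reservoir at `≤ Mc` through `D_δ ≈ (5/2)log_lam(4m³AM/δ²)`
  non-quiet scales below the valve) sustaining activity above the valve for `~ m³A M^{5/3} δ^{-4}`
  valve-clock units ≫ `C M^{2/3} δ^{-2}`; no dynamical witness constructed (no closed forms), so no
  formal kill. REPAIR (sufficient for `LineCloses`, which only needs SOME finite lifetime bound to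
  choose `K` above): take the budget `D_δ` scales deeper —
  `δ² lam^{4(n+1)/5}(t₂-t₁) ≤ C(lam,m,coeff)·(1 + A M) M^{2/3} δ^{-2}` (lifetime `≲ A M^{5/3} δ^{-4}`), or
  keep the stated shape under the extra hypothesis `2m³A M^{1/3} lam^{-3/5} ≤ 1/2`.
* `Ideator3.QuietBlockRegular` — TRUE (sketch): the two maximum principles of (F3) on the
  half-block above a `δ₁`-quiet valve (boundary forcing `O(δ₁²)` from the `(0,0,1)` source,
  `O(δ₁)` coefficients otherwise), then the finitely many scales `≤ n` are bounded by
  `M^{1/3} lam^{19n/5}`.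
VERDICT for the lead/triage: Ideator 3's line (TraceInequality → LateActivitySparse → repaired
ValveBudget + QuietBlockRegular) is a complete forward-in-time route to the crux, consistent with
§§3–5 here; nothing in it is refutable by the disprover's arsenal. -/


/-! ## §7 Targets (cycle 2, 2026-08-16): the six stubs of the lead's line `tilted-trace-gronwall`

The lead's reshaped skeleton `Cruxes/CircuitTrace/Lines/tilted-trace-gronwall.lean` (registered
2026-08-16T02:21) states its stubs over the LANDED vocabulary `Theorems.CircuitTrace.Negative.circuitRHS /
IsCyclic`, which is definitionally this file's §0 (`Targets.circuitRHS_eq_negative` below, `rfl`). The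
disprover attacked each stub AS TYPED (junk instances, quantifier order, casts, dropped hypotheses) and
on paper (does the advertised proof route close with the typed constants?). Verdicts:

* S1 `stub_valveBudget` (IsCyclic, a-priori bound, `sup a ≤ A`; `∀ A ∃ δ₀ ∃ C ∀ δ ≤ δ₀`): TRUE as typed.
  `E_{>n} = Σ_{j>n}Σ_i X_{i,j}²` obeys `Ė = -2Σ_{j>n} lam^{4j/5}e_j + 2π_n` with the cut flux
  `π_n = lam^n Σ coeff(i₁,i₂,i,some 2) X_{i₁,n}X_{i₂,n}X_{i,n+1}` (every base `≥ n+1` is a complete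
  trilinear form, killed by `trilinear_cancel`; bases `≤ n-1` do not reach above `n`);
  `|π_n| ≤ Km² lam^{(2n-1)/5} δ² Σ_i a_{i,n+1}`, and per mode at scale `n+1`,
  `2lam^{2(n+1)/5}(-a² + rδ²a) ≤ lam^{2(n+1)/5} r²δ⁴/2`, `r = Km² lam^{-3/5}` — the leak is absorbed by
  scale `n+1`'s own dissipation and what is left is `O(δ⁴)`, while a `δ`-active mode anywhere above
  dissipates `≥ 2δ² lam^{2(n+1)/5}` (if it sits at `n+1` itself: `-a(a - rδ²) ≤ -δ²/2` once `rδ ≤ 1/2`).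
  Hence `Ė ≤ -(δ²/2) lam^{2(n+1)/5}` for `δ ≤ δ₀(lam,m,K)` and, with
  `E(t₁) ≤ mA² lam^{-2(n+1)/5}/(1 - lam^{-2/5})`, `δ² lam^{4(n+1)/5}(t₂-t₁) ≤ 2mA²/(1-lam^{-2/5}) =: C(lam,m,A)`.
  This REPAIRS the doubt of §6 (cycle 1) about Ideator 3's constant shape: the ratio `r` need not shrink
  with `δ`. Degenerate instances: `m = 0` ⇒ the activity hypothesis is unsatisfiable on `[t₁,t₂] ∋ t₁`;
  `A < 0`, `m ≥ 1` ⇒ the amplitude hypothesis fails at `t = 0`; `t₁ = t₂` ⇒ needs `C ≥ 0` (free).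
  LOAD-BEARING: `Targets.valveBudget_false_without_cyclic` — without `IsCyclic` S1 is FALSE (steady
  Riccati mode). S1 is the only stub of the six that assumes (4.3).
* S2a `stub_blockStaysQuiet` (no IsCyclic): TRUE as typed — first maximum principle
  `d(a²)/dt ≤ 2lam^{4j/5} a (16Km²δ² - a) < 0` at the first touch of level `2δ` (`8Km²δ < 1`); the sup
  over the infinite block is a max by the a-priori bound (`a_j ≤ C'' lam^{-19j/5}` on `[0,T'']`); the
  valve hypothesis covers the neighbour `j - 1 = n`. `δ₁ = 1/(16Km² + 1)` works for every `A`.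
* S2b `stub_quietImpliesRegular` (no IsCyclic): TRUE as typed — `θ`-weighted maximum principle for
  `w_{i,j} = θ^j lam^{4j}|X_{i,j}|`, `j > n`: every monomial has one factor `≤ ε₀` in critical units and
  one `≤ W`, the `(j-1)²` source costs `θ lam^{16/5}`, so `η = ε₀Km²(3 + lam^{16/5}) ≤ 1/2` fixes
  `ε₀(lam,m,K)`; at `j = n+1` the source from the valve is a bounded forcing because `n` is FIXED
  (`lam^{4n}|X_{i,n}| ≤ lam^{19n/5}ε₀`); the bound `max(C_{t₁}, 2β₂) + 1` is uniform in `θ ↑ 1`.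
  `m = 0`: conclusion trivial; `A < 0`: vacuous.
* S4 `stub_tiltedGronwall` (no IsCyclic, no a-priori bound, ANY real `β`): TRUE as typed —
  `|L̇^β_N| ≤ Γ lam^{4N/5} L^β_N` with `Γ = 2 + Km²A⁺(6 + 2lam^{β})`: one-sided coupling puts a factor at a
  scale `≤ N` next to `X_{i,k}` in every monomial, the third factor (possibly at scale `N+1`) is `≤ A⁺lam^{-s/5}`
  by the amplitude hypothesis (which covers all `n : ℤ`), Young, and the `(k-1)²` source is re-weighted at
  price `lam^{β}`; `k = 0` uses the cutoff. Finite sums only, `[t₁,t₂] ⊂ (0,T)`. It plainly needs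
  `sup a ≤ A` (Riccati rates are amplitude-dependent) — not worth a lemma.
* S5 `stub_terminalTrace` (only ODE + cutoff + `ℓ³`): TRUE as typed — for fixed `(i,n)`,
  `|Ẋ_{i,n}| ≤ lam^{4n/5}M'lam^{-n/5} + 4m²K lam^n M'² lam^{-2(n-1)/5}` on `(0,T)` (`M' = max M 1 ≥ a`), so
  `X_{i,n}` is Lipschitz, Cauchy at `T⁻`, has a limit; finite sums pass to the limit along `𝓝[<] T`
  (`T > 0`, filter `NeBot`); `M ≥ 0` is implied (`s = ∅`).
* S6 `stub_traceEndgame` (pure analysis, `1/5 < β`): TRUE as typed — at a front `(n,i,t)`,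
  `Λ_n := Σ_{k≤n}Σ_i lam^{2βk}τ_{i,k}² = lim_{t₂↑T} L_n(t₂) ≥ e^{-Γ⁺R} δ² lam^{(2β-2/5)n}`, i.e.
  `Σ_{k≤n} θ^{n-k} s_k ≥ e^{-Γ⁺R}δ²` with `θ = lam^{-(2β-2/5)} < 1`, `s_k = Σ_iσ_{i,k}²`,
  `σ_{i,k} = lam^{k/5}|τ_{i,k}|`; but `Σσ³ ≤ M` on finite sets gives `s_k ≤ mM^{2/3}` and
  `#{k : s_k ≥ ε} ≤ M(m/ε)^{3/2}`, so the discounted sums tend to `0` (Toeplitz) — contradiction along the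
  infinitely many fronts. `Γ < 0` only strengthens the hypothesis; `R < 0`, `T ≤ 0`, `m = 0` make the
  fronts clause unsatisfiable (statement vacuously true).
  SHARP: `Targets.traceEndgame_false_from_critical_tilt` — at `β = 1/5` (`θ = 1`) S6 is FALSE.

Composition re-checked: `synchrony` (S1+S2a+S2b, sorry-free in the skeleton) ⇒ a `δ`-front within
`R lam^{-4g/5}` of `T` at EVERY large scale `g`; S4 (`β = 2/5`) + S5 + S6 ⇒ no such fronts. Constants
`δ = min δ₀ (min δ₁ (ε₀/2))`, `R = 2C⁺/δ² + 2` consistent. Nothing here is refutable by the disprover's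
arsenal; the crux remains "very probably TRUE" and the line is sound modulo honest analysis in S1–S6.

The Lean below: `circuitRHS_eq_negative` (the work file's §0 IS the landed vocabulary), then verbatim
copies of the two new negative lemmas (their tree homes: `Theorems/CircuitTrace/Negative/
ValveBudgetWithoutCyclic.lean`, `Negative/TraceEndgameCriticalTilt.lean`, proposed `--supports` the crux).
-/

namespace Targets

open Filter Topology
open Summit.NavierStokesRegularity.NavierStokesRegularity.Theorems.CircuitTrace

/-- The work file's circuit right-hand side (§0) is, definitionally, the landed
`Theorems.CircuitTrace.Negative.circuitRHS` over which the lead's stubs are typed. -/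
theorem circuitRHS_eq_negative : @circuitRHS = @Negative.circuitRHS := rfl

/-- Likewise for cyclic cancellation (4.3). -/
theorem isCyclic_eq_negative : @IsCyclic = @Negative.IsCyclic := rfl

/-- Likewise for symmetry (4.2). -/
theorem isSymm_eq_negative : @IsSymm = @Negative.IsSymm := rfl

/-! ### Target S1: the quiet-valve budget is FALSE without cyclic cancellation -/


/-- Stub S1 (`stub_valveBudget`) of the lead's skeleton `Lines/tilted-trace-gronwall.lean` with the
hypothesis `IsCyclic coeff →` DELETED (everything else verbatim). -/
def ValveBudgetWithoutCyclic : Prop :=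
  ∀ lam : ℝ, 1 < lam → ∀ (m : ℕ) (coeff : Fin m → Fin m → Fin m → Option (Fin 3) → ℝ),
    ∀ A : ℝ, ∃ δ₀ : ℝ, 0 < δ₀ ∧ ∃ C : ℝ, ∀ δ : ℝ, 0 < δ → δ ≤ δ₀ →
    ∀ (T : ℝ) (X : Fin m → ℤ → ℝ → ℝ), 0 < T →
    (∀ (i : Fin m) (n : ℤ), ∀ t ∈ Set.Ioo 0 T, HasDerivAt (X i n) (circuitRHS lam coeff X i n t) t) →
    (∀ (i : Fin m) (n : ℤ) (t : ℝ), n < 0 → X i n t = 0) →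
    (∀ T' ∈ Set.Ioo 0 T, ∃ C : ℝ, ∀ (i : Fin m) (n : ℤ), ∀ t ∈ Set.Icc 0 T',
      lam ^ ((4 : ℝ) * n) * |X i n t| ≤ C) →
    (∀ t ∈ Set.Ico 0 T, ∀ (i : Fin m) (n : ℤ), lam ^ ((1 / 5 : ℝ) * n) * |X i n t| ≤ A) →
    ∀ n : ℤ, 0 ≤ n → ∀ t₁ t₂ : ℝ, 0 < t₁ → t₁ ≤ t₂ → t₂ < T →
    (∀ i : Fin m, ∀ t ∈ Set.Icc t₁ t₂, lam ^ ((1 / 5 : ℝ) * n) * |X i n t| ≤ δ) →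
    (∀ t ∈ Set.Icc t₁ t₂, ∃ (i : Fin m) (j : ℤ), n < j ∧ δ ≤ lam ^ ((1 / 5 : ℝ) * j) * |X i j t|) →
    δ ^ 2 * lam ^ ((4 / 5 : ℝ) * (n + 1)) * (t₂ - t₁) ≤ C

/-- The same-scale Riccati circuit: `m = 1`, `coeff(0,0,0,none) = 1`, all transfer constants `0`,
i.e. `Ẋ_n = -lam^{4n/5} X_n + lam^n X_n²` (scales decoupled, NOT energy conserving). -/
def riccatiCoeff : Fin 1 → Fin 1 → Fin 1 → Option (Fin 3) → ℝ :=
  fun _ _ _ μ => if μ = none then 1 else 0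

/-- It obeys Tao's symmetry (4.2) (recorded for completeness; S1 does not even ask for it). -/
theorem riccatiCoeff_symm : IsSymm riccatiCoeff := by
  intro i₁ i₂ i₃ μ
  rcases μ with _ | a <;> simp [riccatiCoeff]

/-- It violates cyclic cancellation (4.3): the orbit sum at offset `none` is `6`. -/
theorem riccatiCoeff_not_cyclic : ¬ IsCyclic riccatiCoeff := by
  intro h
  have := h (fun _ => 0) none
  simp only [riccatiCoeff, Option.map_none, ite_true, Finset.sum_const, Finset.card_univ,
    Fintype.card_perm, Fintype.card_fin, nsmul_eq_mul, mul_one] at this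
  norm_num [Nat.factorial] at this

/-- The steady witness: `X_1 ≡ 1/2`, all other modes `0`. -/
def steadyMode (n : ℤ) (_t : ℝ) : ℝ := if n = 1 then 1 / 2 else 0

/-- `32^x = 2^{5x}`. -/
theorem rpow_thirtytwo (x : ℝ) : (32 : ℝ) ^ x = 2 ^ (5 * x) := by
  rw [show (32 : ℝ) = (2 : ℝ) ^ ((5 : ℕ) : ℝ) by rw [Real.rpow_natCast]; norm_num,
    ← Real.rpow_mul (by norm_num : (0 : ℝ) ≤ 2)]
  norm_num

/-- The clock of scale `1` at `lam = 32`: `32^{4/5} = 16`. -/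
theorem thirtytwo_rpow_four_fifths : (32 : ℝ) ^ ((4 / 5 : ℝ) * ((1 : ℤ) : ℝ)) = 16 := by
  rw [rpow_thirtytwo, show (5 : ℝ) * ((4 / 5 : ℝ) * ((1 : ℤ) : ℝ)) = ((4 : ℕ) : ℝ) by norm_num,
    Real.rpow_natCast]
  norm_num

/-- The critical weight of scale `1` at `lam = 32`: `32^{1/5} = 2`. -/
theorem thirtytwo_rpow_one_fifth : (32 : ℝ) ^ ((1 / 5 : ℝ) * ((1 : ℤ) : ℝ)) = 2 := by
  rw [rpow_thirtytwo, show (5 : ℝ) * ((1 / 5 : ℝ) * ((1 : ℤ) : ℝ)) = ((1 : ℕ) : ℝ) by norm_num,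
    Real.rpow_natCast]
  norm_num

/-- The steady single-mode state solves the Riccati circuit: `F_n ≡ 0` at every scale. -/
theorem circuitRHS_riccati_steady (n : ℤ) (t : ℝ) :
    circuitRHS 32 riccatiCoeff (fun _ => steadyMode) 0 n t = 0 := by
  unfold circuitRHS riccatiCoeff
  simp only [Finset.univ_unique, Fin.default_eq_zero, Finset.sum_singleton, Fintype.sum_option,
    reduceCtorEq, ite_true, ite_false, zero_mul, Finset.sum_const_zero, add_zero, sub_zero]
  unfold steadyMode
  by_cases hn : n = 1
  · subst hn
    simp only [ite_true]
    rw [thirtytwo_rpow_four_fifths, show (((1 : ℤ) : ℝ)) = ((1 : ℕ) : ℝ) by norm_num,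
      Real.rpow_natCast]
    norm_num
  · simp [hn]

/-- The witness trajectory (one mode per scale). -/
def steadyX : Fin 1 → ℤ → ℝ → ℝ := fun _ => steadyMode

/-- Pointwise values of the witness trajectory. -/
theorem steadyX_apply (i : Fin 1) (n : ℤ) (t : ℝ) :
    steadyX i n t = if n = 1 then 1 / 2 else 0 := rfl

/-- **S1 needs cyclic cancellation.** -/
theorem valveBudget_false_without_cyclic : ¬ ValveBudgetWithoutCyclic := by
  intro h
  obtain ⟨δ₀, hδ₀, C, hC⟩ := h 32 (by norm_num) 1 riccatiCoeff 1
  set δ : ℝ := min δ₀ 1 with hδdef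
  have hδpos : 0 < δ := lt_min hδ₀ one_pos
  have hδle : δ ≤ δ₀ := min_le_left _ _
  have hδ1 : δ ≤ 1 := min_le_right _ _
  -- a long window: t₁ = 1, t₂ = 1 + (|C| + 1)/(16 δ²), T = t₂ + 1
  set w : ℝ := (|C| + 1) / (16 * δ ^ 2) with hwdef
  have hw0 : 0 ≤ w := by rw [hwdef]; positivity
  have key := hC δ hδpos hδle (1 + w + 1) steadyX (by linarith)
    (fun i n t _ => by
      have h0 : circuitRHS 32 riccatiCoeff steadyX i n t = 0 := by
        rw [Subsingleton.elim i 0]; exact circuitRHS_riccati_steady n t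
      rw [h0]
      show HasDerivAt (steadyMode n) 0 t
      unfold steadyMode
      exact hasDerivAt_const t _)
    (fun i n t hn => by rw [steadyX_apply i n t]; simp [show n ≠ 1 by omega])
    (fun T' _ => ⟨(32 : ℝ) ^ ((4 : ℝ) * ((1 : ℤ) : ℝ)), fun i n t _ => by
      rw [steadyX_apply i n t]
      by_cases hn : n = 1
      · subst hn
        have : 0 ≤ (32 : ℝ) ^ ((4 : ℝ) * ((1 : ℤ) : ℝ)) := by positivity
        rw [if_pos rfl, abs_of_nonneg (by norm_num : (0 : ℝ) ≤ 1 / 2)]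
        nlinarith
      · simp only [hn, ite_false, abs_zero, mul_zero]; positivity⟩)
    (fun t _ i n => by
      rw [steadyX_apply i n t]
      by_cases hn : n = 1
      · subst hn; rw [thirtytwo_rpow_one_fifth]; norm_num
      · simp only [hn, ite_false, abs_zero, mul_zero]; norm_num)
    0 le_rfl 1 (1 + w) one_pos (by linarith) (by linarith)
    (fun i t _ => by
      rw [steadyX_apply i 0 t]
      simp only [zero_ne_one, ite_false, abs_zero, mul_zero]
      exact hδpos.le)
    (fun t _ => ⟨0, 1, zero_lt_one, by
      rw [steadyX_apply 0 1 t, thirtytwo_rpow_one_fifth]; norm_num; exact hδ1⟩)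
  -- evaluate the budget: δ² · 16 · w = |C| + 1 > C
  have h16 : (32 : ℝ) ^ ((4 / 5 : ℝ) * (((0 : ℤ) : ℝ) + 1)) = 16 := by
    rw [← thirtytwo_rpow_four_fifths]; norm_num
  rw [h16, show (1 + w - 1 : ℝ) = w by ring, hwdef] at key
  have : δ ^ 2 * 16 * ((|C| + 1) / (16 * δ ^ 2)) = |C| + 1 := by
    field_simp
  rw [this] at key
  have := le_abs_self C
  linarith


/-! ### Target S6: the trace endgame is SHARP — FALSE at the critical tilt `β = 1/5` -/


/-- Stub S6 (`stub_traceEndgame`) of the lead's skeleton `Lines/tilted-trace-gronwall.lean` with the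
tilt hypothesis `1 / 5 < β` WEAKENED to `1 / 5 ≤ β` (everything else verbatim). -/
def TraceEndgameFromCriticalTilt : Prop :=
  ∀ lam : ℝ, 1 < lam → ∀ β : ℝ, 1 / 5 ≤ β → ∀ (m : ℕ) (Γ δ R M T : ℝ) (X : Fin m → ℤ → ℝ → ℝ)
    (τ : Fin m → ℤ → ℝ), 0 < δ →
    (∀ (N : ℕ) (t₁ t₂ : ℝ), 0 < t₁ → t₁ ≤ t₂ → t₂ < T →
      Real.exp (-(Γ * lam ^ ((4 / 5 : ℝ) * N) * (t₂ - t₁))) *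
          (∑ k ∈ Finset.range (N + 1), ∑ i : Fin m, lam ^ (2 * β * k) * (X i k t₁) ^ 2)
        ≤ ∑ k ∈ Finset.range (N + 1), ∑ i : Fin m, lam ^ (2 * β * k) * (X i k t₂) ^ 2) →
    (∀ (i : Fin m) (n : ℤ), Filter.Tendsto (X i n) (nhdsWithin T (Set.Iio T)) (nhds (τ i n))) →
    (∀ s : Finset ℤ, ∑ n ∈ s, ∑ i : Fin m, (lam ^ ((1 / 5 : ℝ) * n) * |τ i n|) ^ 3 ≤ M) →
    ¬ (∀ n₀ : ℕ, ∃ n : ℕ, n₀ ≤ n ∧ ∃ i : Fin m, ∃ t ∈ Set.Ioo 0 T,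
        lam ^ ((4 / 5 : ℝ) * n) * (T - t) ≤ R ∧ δ ≤ lam ^ ((1 / 5 : ℝ) * n) * |X i n t|)

/-! ### The tent profile -/

/-- The tent: `0` outside `(1,3)`, peak `1` at `2`, `1`-Lipschitz. -/
def tent (s : ℝ) : ℝ := max 0 (1 - |s - 2|)

/-- `tent ≥ 0`. -/
theorem tent_nonneg (s : ℝ) : 0 ≤ tent s := le_max_left _ _

/-- `tent ≤ 1`. -/
theorem tent_le_one (s : ℝ) : tent s ≤ 1 :=
  max_le zero_le_one (by have := abs_nonneg (s - 2); linarith)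

/-- `tent 2 = 1`. -/
theorem tent_two : tent 2 = 1 := by simp [tent]

/-- `tent s = 0` for `s ≤ 1`. -/
theorem tent_eq_zero_of_le_one {s : ℝ} (hs : s ≤ 1) : tent s = 0 := by
  unfold tent
  rw [max_eq_left]
  rw [abs_of_nonpos (by linarith)]
  linarith

/-- `tent s = 0` for `3 ≤ s`. -/
theorem tent_eq_zero_of_three_le {s : ℝ} (hs : 3 ≤ s) : tent s = 0 := by
  unfold tent
  rw [max_eq_left]
  rw [abs_of_nonneg (by linarith)]
  linarith

/-- `tent s ≠ 0` forces `1 < s < 3`. -/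
theorem one_lt_and_lt_three_of_tent_ne_zero {s : ℝ} (hs : tent s ≠ 0) : 1 < s ∧ s < 3 := by
  by_contra h
  rw [not_and_or, not_lt, not_lt] at h
  rcases h with h | h
  · exact hs (tent_eq_zero_of_le_one h)
  · exact hs (tent_eq_zero_of_three_le h)

/-- The tent is `1`-Lipschitz. -/
theorem abs_tent_sub_tent_le (a b : ℝ) : |tent a - tent b| ≤ |a - b| := by
  unfold tent
  have h1 : |max 0 (1 - |a - 2|) - max 0 (1 - |b - 2|)|
      ≤ max |(0 : ℝ) - 0| |(1 - |a - 2|) - (1 - |b - 2|)| := abs_max_sub_max_le_max _ _ _ _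
  have h2 : |(1 - |a - 2|) - (1 - |b - 2|)| ≤ |a - b| := by
    rw [show (1 - |a - 2|) - (1 - |b - 2|) = |b - 2| - |a - 2| by ring]
    refine (abs_abs_sub_abs_le_abs_sub _ _).trans ?_
    rw [show (b - 2) - (a - 2) = b - a by ring, abs_sub_comm]
  have h3 : max |(0 : ℝ) - 0| |(1 - |a - 2|) - (1 - |b - 2|)| ≤ |a - b| := by
    rw [sub_self, abs_zero]
    exact max_le (abs_nonneg _) h2
  exact h1.trans h3

/-- Squares of tents are `2`-Lipschitz. -/
theorem tent_sq_sub_tent_sq_le (a b : ℝ) : tent a ^ 2 - tent b ^ 2 ≤ 2 * |a - b| := by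
  have h1 : tent a ^ 2 - tent b ^ 2 = (tent a + tent b) * (tent a - tent b) := by ring
  have h2 : |tent a + tent b| ≤ 2 := by
    rw [abs_of_nonneg (add_nonneg (tent_nonneg a) (tent_nonneg b))]
    linarith [tent_le_one a, tent_le_one b]
  calc tent a ^ 2 - tent b ^ 2 ≤ |tent a ^ 2 - tent b ^ 2| := le_abs_self _
    _ = |tent a + tent b| * |tent a - tent b| := by rw [h1, abs_mul]
    _ ≤ 2 * |a - b| :=
        mul_le_mul h2 (abs_tent_sub_tent_le a b) (abs_nonneg _) (by norm_num)

/-- The tent is continuous. -/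
theorem continuous_tent : Continuous tent := by
  unfold tent; fun_prop

/-! ### The witness -/

/-- The front at scale `k ≥ 1`: `2^{-k} · tent (16^k (1 - t))`. -/
def front (k : ℕ) (t : ℝ) : ℝ := (1 / 2 : ℝ) ^ k * tent (16 ^ k * (1 - t))

/-- The witness functions: floor `2` at scale `0`, fronts above, nothing below. -/
def cexX : Fin 1 → ℤ → ℝ → ℝ :=
  fun _ n t => if n = 0 then 2 else if 0 < n then front n.toNat t else 0

/-- The witness traces: `2` at scale `0`, `0` elsewhere. -/
def cexTrace : Fin 1 → ℤ → ℝ := fun _ n => if n = 0 then 2 else 0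

/-- `32^x = 2^{5x}`. -/
theorem rpow_thirtytwo' (x : ℝ) : (32 : ℝ) ^ x = 2 ^ (5 * x) := by
  rw [show (32 : ℝ) = (2 : ℝ) ^ ((5 : ℕ) : ℝ) by rw [Real.rpow_natCast]; norm_num,
    ← Real.rpow_mul (by norm_num : (0 : ℝ) ≤ 2)]
  norm_num

/-- Clocks at `lam = 32`: `32^{4N/5} = 16^N`. -/
theorem thirtytwo_rpow_clock (N : ℕ) : (32 : ℝ) ^ ((4 / 5 : ℝ) * (N : ℝ)) = 16 ^ N := by
  rw [rpow_thirtytwo', show (5 : ℝ) * ((4 / 5 : ℝ) * (N : ℝ)) = ((4 * N : ℕ) : ℝ) by push_cast; ring,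
    Real.rpow_natCast, pow_mul]
  norm_num

/-- Critical weights at `lam = 32`: `32^{n/5} = 2^n`. -/
theorem thirtytwo_rpow_crit (n : ℕ) : (32 : ℝ) ^ ((1 / 5 : ℝ) * (n : ℝ)) = 2 ^ n := by
  rw [rpow_thirtytwo', show (5 : ℝ) * ((1 / 5 : ℝ) * (n : ℝ)) = ((n : ℕ) : ℝ) by ring,
    Real.rpow_natCast]

/-- Critical `ℓ²` weights at `lam = 32`, `β = 1/5`: `32^{2k/5} = 4^k`. -/
theorem thirtytwo_rpow_crit_sq (k : ℕ) : (32 : ℝ) ^ (2 * (1 / 5 : ℝ) * (k : ℝ)) = 4 ^ k := by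
  rw [rpow_thirtytwo', show (5 : ℝ) * (2 * (1 / 5 : ℝ) * (k : ℝ)) = ((2 * k : ℕ) : ℝ) by push_cast; ring,
    Real.rpow_natCast, pow_mul]
  norm_num

/-- The witness read at a natural scale. -/
theorem cexX_natCast (i : Fin 1) (k : ℕ) (t : ℝ) :
    cexX i (k : ℤ) t = if k = 0 then 2 else front k t := by
  unfold cexX
  by_cases hk : k = 0
  · simp [hk]
  · simp [hk]

/-- The summand of the critical block energy: `4` at scale `0`, `tent(16^k(1-t))²` above. -/
theorem cex_term (k : ℕ) (t : ℝ) :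
    ∑ i : Fin 1, (32 : ℝ) ^ (2 * (1 / 5 : ℝ) * (k : ℝ)) * (cexX i (k : ℤ) t) ^ 2
      = if k = 0 then 4 else tent (16 ^ k * (1 - t)) ^ 2 := by
  rw [Finset.univ_unique, Finset.sum_singleton, cexX_natCast, thirtytwo_rpow_crit_sq]
  by_cases hk : k = 0
  · simp [hk]; norm_num
  · simp only [hk, ite_false, front]
    rw [mul_pow, ← mul_assoc, ← pow_mul, pow_mul', ← mul_pow,
      show (4 : ℝ) * (1 / 2) ^ 2 = 1 by norm_num, one_pow, one_mul]

/-- The critical block energy of the witness: floor `4` plus the fronts. -/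
theorem cex_blockEnergy (N : ℕ) (t : ℝ) :
    ∑ k ∈ Finset.range (N + 1), ∑ i : Fin 1, (32 : ℝ) ^ (2 * (1 / 5 : ℝ) * (k : ℝ)) * (cexX i (k : ℤ) t) ^ 2
      = 4 + ∑ k ∈ Finset.range N, tent (16 ^ (k + 1) * (1 - t)) ^ 2 := by
  rw [Finset.sum_congr rfl fun k _ => cex_term k t, Finset.sum_range_succ']
  simp only [Nat.succ_ne_zero, ite_false, ite_true]
  ring

/-- AT MOST ONE FRONT IS ALIVE: for `s > 0` the scales `k` with `16^{k+1} s ∈ (1,3)` form a set of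
at most one element, so the fronts' contribution to the block energy is `≤ 1`. -/
theorem sum_tent_sq_le_one (N : ℕ) {s : ℝ} (hs : 0 < s) :
    ∑ k ∈ Finset.range N, tent (16 ^ (k + 1) * s) ^ 2 ≤ 1 := by
  by_cases h : ∃ k₀ ∈ Finset.range N, tent (16 ^ (k₀ + 1) * s) ≠ 0
  · obtain ⟨k₀, hk₀, hne⟩ := h
    obtain ⟨hlo, hhi⟩ := one_lt_and_lt_three_of_tent_ne_zero hne
    have hzero : ∀ k ∈ Finset.range N, k ≠ k₀ → tent (16 ^ (k + 1) * s) ^ 2 = 0 := by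
      intro k _ hk
      rcases lt_or_gt_of_ne hk with hlt | hgt
      · -- k < k₀: the argument is ≤ 16^{k₀} s = (16^{k₀+1} s)/16 < 3/16 < 1
        have hle : (16 : ℝ) ^ (k + 1) * s ≤ 16 ^ k₀ * s := by
          have : (16 : ℝ) ^ (k + 1) ≤ 16 ^ k₀ := pow_le_pow_right₀ (by norm_num) (by omega)
          exact mul_le_mul_of_nonneg_right this hs.le
        have h16 : (16 : ℝ) ^ (k₀ + 1) * s = 16 * (16 ^ k₀ * s) := by ring
        rw [h16] at hhi
        rw [tent_eq_zero_of_le_one (by linarith), zero_pow two_ne_zero]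
      · -- k > k₀: the argument is ≥ 16^{k₀+2} s = 16 · (16^{k₀+1} s) > 16 > 3
        have hle : (16 : ℝ) ^ (k₀ + 2) * s ≤ 16 ^ (k + 1) * s := by
          have : (16 : ℝ) ^ (k₀ + 2) ≤ 16 ^ (k + 1) := pow_le_pow_right₀ (by norm_num) (by omega)
          exact mul_le_mul_of_nonneg_right this hs.le
        have h16 : (16 : ℝ) ^ (k₀ + 2) * s = 16 * (16 ^ (k₀ + 1) * s) := by ring
        rw [h16] at hle
        rw [tent_eq_zero_of_three_le (by linarith), zero_pow two_ne_zero]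
    rw [Finset.sum_eq_single_of_mem k₀ hk₀ hzero]
    have h0 := tent_nonneg (16 ^ (k₀ + 1) * s)
    have h1 := tent_le_one (16 ^ (k₀ + 1) * s)
    nlinarith
  · push Not at h
    rw [Finset.sum_eq_zero fun k hk => by rw [h k hk, zero_pow two_ne_zero]]
    exact zero_le_one

/-- THE FRONTS DROP SLOWLY IN ABSOLUTE TERMS: over `[t₁, t₂]` the fronts' block energy up to scale
`N` decreases by at most `3 · 16^N · (t₂ - t₁)` (tents are `1`-Lipschitz, clocks sum
geometrically). -/
theorem sum_tent_sq_drop_le (N : ℕ) {t₁ t₂ : ℝ} (h : t₁ ≤ t₂) :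
    ∑ k ∈ Finset.range N, tent (16 ^ (k + 1) * (1 - t₁)) ^ 2
        - ∑ k ∈ Finset.range N, tent (16 ^ (k + 1) * (1 - t₂)) ^ 2
      ≤ 3 * 16 ^ N * (t₂ - t₁) := by
  rw [← Finset.sum_sub_distrib]
  have hterm : ∀ k ∈ Finset.range N,
      tent (16 ^ (k + 1) * (1 - t₁)) ^ 2 - tent (16 ^ (k + 1) * (1 - t₂)) ^ 2
        ≤ 2 * (t₂ - t₁) * 16 ^ (k + 1) := by
    intro k _
    refine (tent_sq_sub_tent_sq_le _ _).trans ?_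
    rw [show (16 : ℝ) ^ (k + 1) * (1 - t₁) - 16 ^ (k + 1) * (1 - t₂) = 16 ^ (k + 1) * (t₂ - t₁) by ring,
      abs_of_nonneg (by positivity)]
    nlinarith
  refine (Finset.sum_le_sum hterm).trans ?_
  rw [← Finset.mul_sum]
  have hgeom : ∑ k ∈ Finset.range N, (16 : ℝ) ^ (k + 1) ≤ 16 ^ (N + 1) / 15 := by
    have := geom_sum_eq (show (16 : ℝ) ≠ 1 by norm_num) N
    rw [show ∑ k ∈ Finset.range N, (16 : ℝ) ^ (k + 1) = 16 * ∑ k ∈ Finset.range N, (16 : ℝ) ^ k by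
      rw [Finset.mul_sum]; refine Finset.sum_congr rfl fun k _ => by ring, this]
    have h16N : (0 : ℝ) ≤ 16 ^ N := by positivity
    rw [pow_succ]
    nlinarith
  have ht : 0 ≤ 2 * (t₂ - t₁) := by linarith
  calc 2 * (t₂ - t₁) * ∑ k ∈ Finset.range N, (16 : ℝ) ^ (k + 1)
      ≤ 2 * (t₂ - t₁) * (16 ^ (N + 1) / 15) := mul_le_mul_of_nonneg_left hgeom ht
    _ ≤ 3 * 16 ^ N * (t₂ - t₁) := by rw [pow_succ]; nlinarith [pow_nonneg (by norm_num : (0:ℝ) ≤ 16) N]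

/-- `e^{-x} ≤ 1/(1+x)` for `x ≥ 0`. -/
theorem exp_neg_le_inv_one_add {x : ℝ} (hx : 0 ≤ x) : Real.exp (-x) ≤ 1 / (1 + x) := by
  rw [Real.exp_neg, ← one_div]
  exact one_div_le_one_div_of_le (by linarith) (by linarith [Real.add_one_le_exp x])

/-- THE WITNESS OBEYS THE CRITICAL (UNTILTED) GRÖNWALL INEQUALITY with `Γ = 2`. -/
theorem cex_gronwall (N : ℕ) (t₁ t₂ : ℝ) (ht₁₂ : t₁ ≤ t₂) (ht₂ : t₂ < 1) :
    Real.exp (-(2 * (32 : ℝ) ^ ((4 / 5 : ℝ) * N) * (t₂ - t₁))) *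
        (∑ k ∈ Finset.range (N + 1), ∑ i : Fin 1,
          (32 : ℝ) ^ (2 * (1 / 5 : ℝ) * (k : ℝ)) * (cexX i (k : ℤ) t₁) ^ 2)
      ≤ ∑ k ∈ Finset.range (N + 1), ∑ i : Fin 1,
          (32 : ℝ) ^ (2 * (1 / 5 : ℝ) * (k : ℝ)) * (cexX i (k : ℤ) t₂) ^ 2 := by
  rw [cex_blockEnergy, cex_blockEnergy, thirtytwo_rpow_clock]
  set S₁ := ∑ k ∈ Finset.range N, tent (16 ^ (k + 1) * (1 - t₁)) ^ 2 with hS₁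
  set S₂ := ∑ k ∈ Finset.range N, tent (16 ^ (k + 1) * (1 - t₂)) ^ 2 with hS₂
  set u : ℝ := 16 ^ N * (t₂ - t₁) with hu
  have hu0 : 0 ≤ u := by rw [hu]; exact mul_nonneg (by positivity) (by linarith)
  have hS₁le : S₁ ≤ 1 := sum_tent_sq_le_one N (by linarith)
  have hS₂ge : 0 ≤ S₂ := Finset.sum_nonneg fun k _ => sq_nonneg _
  have hdrop : S₁ - S₂ ≤ 3 * u := by
    have := sum_tent_sq_drop_le N ht₁₂
    rw [hu]; linarith
  have hexp : Real.exp (-(2 * 16 ^ N * (t₂ - t₁))) = Real.exp (-(2 * u)) := by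
    rw [hu]; ring_nf
  rw [hexp]
  have hL₁ : 0 ≤ 4 + S₁ := by
    have : 0 ≤ S₁ := Finset.sum_nonneg fun k _ => sq_nonneg _
    linarith
  by_cases hcase : 2 * u ≤ 1
  · -- short windows: e^{-2u} ≤ 1/(1+2u) and (4+S₁)/(1+2u) ≤ 4 + S₁ - 3u ≤ 4 + S₂
    have h1 : Real.exp (-(2 * u)) ≤ 1 / (1 + 2 * u) := exp_neg_le_inv_one_add (by linarith)
    have hS₁ge : 0 ≤ S₁ := Finset.sum_nonneg fun k _ => sq_nonneg _
    have h2 : 1 / (1 + 2 * u) * (4 + S₁) ≤ 4 + S₁ - 3 * u := by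
      rw [div_mul_eq_mul_div, one_mul, div_le_iff₀ (by linarith)]
      nlinarith [mul_nonneg hu0 hS₁ge, mul_nonneg hu0 (by linarith : (0 : ℝ) ≤ 1 - 2 * u)]
    calc Real.exp (-(2 * u)) * (4 + S₁) ≤ 1 / (1 + 2 * u) * (4 + S₁) :=
          mul_le_mul_of_nonneg_right h1 hL₁
      _ ≤ 4 + S₁ - 3 * u := h2
      _ ≤ 4 + S₂ := by linarith
  · -- long windows: e^{-2u} ≤ e^{-1} ≤ 1/2 and (4 + S₁)/2 ≤ 5/2 ≤ 4 ≤ 4 + S₂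
    push Not at hcase
    have h1 : Real.exp (-(2 * u)) ≤ 1 / 2 := by
      have he : Real.exp (-(2 * u)) ≤ Real.exp (-1) := Real.exp_le_exp.mpr (by linarith)
      have he1 : Real.exp (-1) ≤ 1 / 2 := by
        rw [Real.exp_neg]
        rw [show (1 / 2 : ℝ) = (2 : ℝ)⁻¹ by norm_num]
        exact inv_anti₀ (by norm_num) (by linarith [Real.add_one_le_exp (1 : ℝ)])
      exact he.trans he1
    calc Real.exp (-(2 * u)) * (4 + S₁) ≤ 1 / 2 * (4 + S₁) :=
          mul_le_mul_of_nonneg_right h1 hL₁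
      _ ≤ 4 + S₂ := by linarith

/-- The fronts are continuous in time. -/
theorem continuous_front (k : ℕ) : Continuous (front k) := by
  unfold front
  exact continuous_const.mul (continuous_tent.comp (by fun_prop))

/-- The fronts are over at `t = 1`. -/
theorem front_one (k : ℕ) : front k 1 = 0 := by
  simp [front, tent_eq_zero_of_le_one]

/-- TERMINAL TRACES of the witness: `2` at scale `0`, `0` elsewhere. -/
theorem cex_tendsto (i : Fin 1) (n : ℤ) :
    Filter.Tendsto (cexX i n) (nhdsWithin 1 (Set.Iio 1)) (nhds (cexTrace i n)) := by
  unfold cexX cexTrace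
  by_cases h0 : n = 0
  · simp only [h0, ite_true]; exact tendsto_const_nhds
  · simp only [h0, ite_false]
    by_cases hpos : 0 < n
    · simp only [hpos, ite_true]
      have := ((continuous_front n.toNat).tendsto 1).mono_left (nhdsWithin_le_nhds (s := Set.Iio 1))
      rwa [front_one] at this
    · simp only [hpos, ite_false]; exact tendsto_const_nhds

/-- TRACE BOUND: `Σ_{n ∈ s} (32^{n/5} |τ_n|)³ ≤ 8`. -/
theorem cex_trace_l3 (s : Finset ℤ) :
    ∑ n ∈ s, ∑ i : Fin 1, ((32 : ℝ) ^ ((1 / 5 : ℝ) * n) * |cexTrace i n|) ^ 3 ≤ 8 := by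
  have hterm : ∀ n ∈ s, ∑ i : Fin 1, ((32 : ℝ) ^ ((1 / 5 : ℝ) * n) * |cexTrace i n|) ^ 3
      = if n = 0 then 8 else 0 := by
    intro n _
    rw [Finset.univ_unique, Finset.sum_singleton]
    unfold cexTrace
    by_cases h0 : n = 0
    · subst h0; norm_num
    · simp [h0]
  rw [Finset.sum_congr rfl hterm, Finset.sum_ite_eq']
  split_ifs <;> norm_num

/-- PACED FRONTS at level `1`, pace `2`, at every scale `n ≥ 1`. -/
theorem cex_fronts (n₀ : ℕ) : ∃ n : ℕ, n₀ ≤ n ∧ ∃ i : Fin 1, ∃ t ∈ Set.Ioo (0 : ℝ) 1,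
    (32 : ℝ) ^ ((4 / 5 : ℝ) * n) * (1 - t) ≤ 2 ∧ 1 ≤ (32 : ℝ) ^ ((1 / 5 : ℝ) * n) * |cexX i n t| := by
  refine ⟨max n₀ 1, le_max_left _ _, 0, 1 - 2 / 16 ^ (max n₀ 1), ⟨?_, ?_⟩, ?_, ?_⟩
  · have h16 : (16 : ℝ) ≤ 16 ^ (max n₀ 1) := by
      calc (16 : ℝ) = 16 ^ 1 := (pow_one _).symm
        _ ≤ 16 ^ (max n₀ 1) := pow_le_pow_right₀ (by norm_num) (le_max_right _ _)
    have : (2 : ℝ) / 16 ^ (max n₀ 1) ≤ 2 / 16 := div_le_div_of_nonneg_left (by norm_num) (by norm_num) h16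
    linarith
  · have : (0 : ℝ) < 2 / 16 ^ (max n₀ 1) := by positivity
    linarith
  · rw [thirtytwo_rpow_clock]
    have h16 : (0 : ℝ) < 16 ^ (max n₀ 1) := by positivity
    rw [show (16 : ℝ) ^ (max n₀ 1) * (1 - (1 - 2 / 16 ^ (max n₀ 1))) = 2 by field_simp; ring]
  · rw [thirtytwo_rpow_crit, cexX_natCast]
    have hne : max n₀ 1 ≠ 0 := by omega
    simp only [hne, ite_false, front]
    have h16 : (16 : ℝ) ^ (max n₀ 1) ≠ 0 := by positivity
    rw [show (16 : ℝ) ^ (max n₀ 1) * (1 - (1 - 2 / 16 ^ (max n₀ 1))) = 2 by field_simp; ring, tent_two,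
      mul_one, abs_of_nonneg (by positivity), ← mul_pow]
    norm_num

/-- **Stub S6 is sharp: the trace endgame fails at the critical tilt `β = 1/5`.** -/
theorem traceEndgame_false_from_critical_tilt : ¬ TraceEndgameFromCriticalTilt := by
  intro h
  have := h 32 (by norm_num) (1 / 5) le_rfl 1 2 1 2 8 1 cexX cexTrace one_pos
    (fun N t₁ t₂ _ ht₁₂ ht₂ => cex_gronwall N t₁ t₂ ht₁₂ ht₂) cex_tendsto cex_trace_l3
  exact this cex_fronts


end Targets

end Summit.NavierStokesRegularity.NavierStokesRegularity.Cruxes.CircuitTrace.Disproof
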